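import Literature.MathematicalPhysics.QuantumFieldTheory.Balaban1983to89.B9SupplySockB9P3ZdOmega
import Literature.MathematicalPhysics.QuantumFieldTheory.Balaban1983to89.B8LanF146

/-!
# `Balaban1983to89.B9SupplySockB9P3ZdSrc` — THE J-N06→N05 JUNCTION WITH SOURCE: [Balaban1985BackgroundPropagators] THEOREM 3.3 (BY NAME) AT THE
# `ℤᵈ × 𝔸` CARRIER SUPPLIES THE SOURCED b9 SOCKETS OF [Balaban1985RegularSpaces] THEOREM 8 ((1.146) «R(U₀)D^{η*}_{U₀}A = f, R(U₀)f = f») at the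
# members with `Ω₀ = ℤᵈ` — the `SB9srcH` (Proposition-3 frame) and `SH59src` (Theorem-4 frame, `LanF146` per level) binders of the N05 record knit

statement-level skeleton of published theorems with citation tags; proofs where landed; nothing here is a claim about the
Yang–Mills mass gap

PDF held: `paper:balaban1985-cmp99-regular-spaces-gauge-fixing` (B8; journal page = PDF page + 74): p. 86 (1.55)–(1.59), p. 87 Prop. 3, p. 88 Thm 4,
p. 92 («from Theorems 3.1, 3.2 of [4] it follows |Rf| ≤ B′₀|f|»), p. 101 (1.146) + Theorem 8 («where f is a function from the space R(U₀) … satisfying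
R(U₀)f = f … it is enough to assume that |f|₍₋₂₎ < γ(α₀ + α₁) … Inspecting the proofs of the theorems and propositions we can see easily that they work in
this more general situation almost without any changes, only some constants change their numerical values»); `paper:balaban1985-cmp99-background-propagators`
([4] = B9; journal page = PDF page + 388): p. 394 (3.20)–(3.25), p. 395 (3.26)–(3.27), p. 397–398 (3.41)–(3.47), p. 399 Thm 3.3, p. 404 (3.69).  Read by this seat
on the held text layers (2026-08-27).

WHY THIS FILE (cell `pub-ymgap`, seat `pub-ymgap-dag-n06-b` g5, junction J-N06→N05; count-neutral).  The N05 record knit at the `Ω₀ = ℤᵈ` law members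
(dag-n05-d `…N05SubBHKnitUnivT8Srv`, p521275) displays THREE b9 binders: `SB9all` (served modulo the N06 letters by `B9SupplySockB9P3ZdOmega.
sockB9P3_allLevels_of_thm33_univ`) and the two SOURCED ones of Theorem 8's frame — `SB9srcH` (Prop. 3's frame at (1.146): all five (1.59) lines with an
additive `γ″B₀(α₀ + α₁)`, Hölder `γβ(α₀ + α₁)`) and `SH59src` (Thm 4's frame: the two lines at every truncation level `m`, gauge condition `LanF146`, additive
`γ′B₀(α₀ + α₁)`).  Print's Theorem 8 (p. 101) says the source changes «only some constants»: with `R(U₀)(D^{η*}A − f) = 0` the `DRD*` term of `Δ_aA`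
((3.26)) is `D R(U₀)f` instead of `0`, so (1.58) reads `A = G(U₀)(J + Δ′A + Q*aQA) + G(U₀)D R(U₀)f`, and the extra term is bounded by the `G∇*`-type entry of
Theorem 3.3 ((3.42)₃∕(3.47)) composed with the bound on `R` (p. 92) from `|f|₍₋₂₎` ALONE — no gradient of `f` (the source is in `R(U₀)`, not smooth).  THIS FILE
types that sentence as ONE more operator-letter binder on print's class E(Ω₀) — `SourceTermDom` (+ its Hölder companion `SourceHolderDom`, + the linearity
of `G`, `GopAdd`) — and runs the junction of `B9SupplySockB9P3ZdOmega` §3 with it.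

WHAT IS DECLARED ∕ PROVED.
* §1 (definitions) `GopAdd` (G(U₀) is additive — (3.27), a linear operator); `SourceTermDom` (for `A ∈ E(Ω₀)`, a source `f` with bounded `(Lʲη)²`-family and
  the multiplier clause «`Δ↾Ω₀(D^{η*}_{U₀}A − f) = Q′_m(U₀)ᵀμ` on `Ω₀`» = «`R_m(U₀)(D^{η*}A − f) = 0`» — the first conjunct of `B8LanF146.LanF146`, the second of
  `B8Eq138LandauZd.IsLandau146` — the field `G(U₀)(DRD*A)` is uniformly bounded and its (1.59) lines 1, 2, 4 are `≤ c_S·|f|₍₋₂₎`, `|f|₍₋₂₎` the consumer's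
  site-indexed norm at the member's top level); `SourceHolderDom` (the Hölder line of the same field, with its `Bdd` guard).
* §2 (theorems) bookkeeping: `msup_eq_zero_of_not_bdd` (r05's junk value), `msup_le_add_of_norm_le`, `hquot_add_le`∕`hquot_sub_le`, `mulClause_congr`
  (the clause reads `A` on the bonds of `Ω₀` only), `apriori_arith_src` (the Neumann arithmetic with an additive source).
* §3 ★ `sockSrc_core_at_univ` — AT A MEMBER WITH `Ω₀ = ℤᵈ`: Theorem 3.3's two blocks at `(M, i, m)` + `DictGlob` + `Prop6Feed` + `InvOnDom`∕`CurvSmallDom`∕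
  `AvgBoundDom`∕`HolderGlob` + `GopAdd`∕`SourceTermDom`∕`SourceHolderDom` ⟹ for every datum (α₀, α₂ ≤ cP; `U₀ ∈ 𝔄_m`; `A′` with (1.41) on the collar sides and the
  multiplier clause at level `m` against a source `f` with bounded `(Lʲη)²`-family) the five (1.59) lines with right-hand sides `B₀′(|J|₍₋₃₎ + |B₁|) + 2c_S|f|₍₋₂₎`
  (lines 1, 2, 4), `B₀′(|J|₍₋₃₎ + |B₁|)` (line 3), `B₀β′(|J|₍₋₃₎ + |B₁|) + (C_β c_S∕B₀ + c_Sβ)|f|₍₋₂₎` (Hölder).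
* §4 ★★ `sockB9P3srcH_of_thm33_univ` — `B9.Thm33Printed` BY NAME over any `ι : J → ZdIdx d L` with `(ι j).Ω 0 = Set.univ` ⟹ constants `B₀′ > 0`, `B₀β ≥ 0`,
  `cP > 0`, `γ″ ≥ 0`, `γβ ≥ 0` with the `SB9srcH` BODY of p521275 VERBATIM at every `ι j` (for the consumer's `γ₈ ≥ 0`); ★★ `sockH59src_of_thm33_univ` — the
  `SH59src` BODY of p521275 VERBATIM at every `ι j` (constants `B₀′`, `c59 = min cP (cP∕K₀)`, `γ′ = 2c_Sγ₈∕B₀′`; any smallness constants `B₈ > 0`, `B₀″ ≥ 0`).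

HONEST CENSUS.  (a) Used from the sourced binders' hypothesis lists: `U₀ ∈ 𝔄`, the exponent field's (1.41) bounds and support clause, the multiplier clause
(`IsLandau146W`'s second conjunct ∕ `LanF146`'s first), `Bdd` and `|f|₍₋₂₎ < γ₈(α₀ + α₁)` of the source; NOT used: `f ∈ R(U₀)` (`InR138`), `f` Hermitian, `f = 0`
off `Ω₀`, `|∇f|₍₋₃₎ < γ₈(α₀ + α₁)`, `WU₀ ∈ 𝔄`, «A′ Hermitian», `Restr129`, the avg-closeness clauses — exactly as print («|f|₍₋₂₎ < γ(α₀ + α₁)» is the only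
source hypothesis of Theorem 8).  (b) The new binder is the printed sentence p. 101 «only some constants change» made explicit: `G(U₀)·D·R_m(U₀)` bounded from
`|·|₍₋₂₎` into the four local norms ([4] (3.42)₃∕(3.47) entry `G∇*`, (3.25), B8 p. 92); at `m < k` print's `R_m f ≠ f` in general (dag-n05-c's located point)
— the binder is stated for `R_m` at every level, as the consumer's `LanF146` is.  (c) Why not «`|DRD*A|₍₋₃₎ ≤ c|f|₍₋₂₎`»: FALSE for print's objects (a source
in `R(U₀)` need not be smooth, `|D f|₍₋₃₎` is not controlled by `|f|₍₋₂₎`); the extra term must be routed through `G(U₀)D` as a unit — hence `GopAdd`.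
(d) SATISFIABILITY: by print's objects at every law-abiding `Ω₀ = ℤᵈ` member iff [4] Sect. A + Thm 3.3 hold there (N06's object-bound, NOT claimed); no
certified refutation applies (ref-A READ-13 on p521275).  (e) Count-neutral; N05∕N06 NOT discharged; one finite lattice programme; nothing continuum ∕ ℝ⁴ ∕ OS ∕
mass-gap ∕ Clay.  Unit `pub-ymgap-dag-n06-b` (g5), 2026-08-27.
-/

noncomputable section

open NormedSpace

namespace Literature.MathematicalPhysics.QuantumFieldTheory.Balaban1983to89.B9SupplySockB9P3ZdSrc

open Complex (I)
open MatrixLog B7Prop1Explicit B7Prop2Explicit B7Prop1Local B7Eq92Concrete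
open B7Prop4GeneralLevels (linCovIter)
open B7Eq78Linearization (conjR)
open B8Ineq132 (covDerivFwd covDeriv InAk BondTouches)
open B8Eq119TwistedAxial (Restr129 InAx)
open B8Eq184Proof (cfgExp)
open B8Lemma1NonAbelian (mulCfg)
open B8Eq140Level (SideTouches)
open B8Eq146AExpansion (iEta plaqCovDeriv)
open B8Eq143PlaqExpansion (pdiv)
open B8Eq155JBound (Jcur wsup)
open B8ScaledSupNorm (bondNorm msup weight Bdd)
open B8Eq138LandauZd (IsLandau138 IsLandau138W IsLandau146 IsLandau146W InR138 QT covDivB logCfg covLap)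
open B8LanF146 (LanF146)
open B8LeafModelZd (ZdIdx)
open B9Eq340HolderZd (hquot AdmPair trans)
open B9SupplySockB9P3ZdLetters (OpsZd deltaAOf DictGlob Prop6Feed HolderGlob)
open B9SupplySockB9P3ZdLettersOmega (OnDom InvOnDom CurvSmallDom AvgBoundDom)
open B8Prop3GaugeFixedKLevel (mem_unitaryUnits_of_mgauge_eq mulCfg_eq_gaugeAct_of_mgauge_eq)

-- `Site` alone could resolve to the torus sites of `Setup.lean`; re-export the `ℤ^d` sites of `B7Prop1Explicit`.
export B7Prop1Explicit (Site)

variable {d : ℕ} {𝔸 : Type*} [CStarAlgebra 𝔸]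

/-! ## §1 The source binders of B8 p. 101 on E(Ω₀) -/

section Binders

variable {I : Type} (bg : I → B9.Backgrounds)
variable (L : ℕ) (mem : ℝ → ZdIdx d L → ℕ → I)
variable (ιCfg : ∀ (M : ℝ) (i : ZdIdx d L) (m : ℕ) (U₀ : Site d → Fin d → 𝔸ˣ),
  (∀ x κ, U₀ x κ ∈ unitaryUnits 𝔸) → (bg (mem M i m)).Cfg)

/-- **`G(U₀)` IS ADDITIVE** — the letter `Gop U₀` of (3.27) is a linear operator («we denote its inverse again by G»).  Needed to route the source term of
(1.146) through `G(U₀)D` as a unit: `G(U₀)(J̃₁ + DRD*A) = G(U₀)J̃₁ + G(U₀)DRD*A`. [cite: Balaban1985BackgroundPropagators, (3.27) p.395] -/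
def GopAdd (ops : ℝ → ZdIdx d L → ℕ → OpsZd d 𝔸) : Prop :=
  ∀ (M : ℝ) (i : ZdIdx d L) (m : ℕ) (U₀ : Site d → Fin d → 𝔸ˣ) (J₁ J₂ : Site d → Fin d → 𝔸),
    (ops M i m).Gop U₀ (J₁ + J₂) = (ops M i m).Gop U₀ J₁ + (ops M i m).Gop U₀ J₂

/-- **THE SOURCE TERM OF (1.146) THROUGH `G(U₀)D R(U₀)`** (B8 p. 101 «f is a function from the space R(U₀) … |f|₍₋₂₎ < γ(α₀ + α₁) … Inspecting the proofs …
only some constants change»; p. 92 «from Theorems 3.1, 3.2 of [4] it follows |Rf| ≤ B′₀|f|»; [4] (3.20)–(3.25) the projection `R(U) = I − G′Q′*(Q′G′²Q′*)⁻¹Q′G′`,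
(3.26) `Δ_a = Δ + DRD* + Q*aQ`, Thm 3.3 with the `G∇*` entry of (3.42)∕(3.47)): for a regular background (Theorem 3.11's regime), a field `A ∈ E(Ω₀)` and a source `f`
with bounded `(Lʲη)²`-weighted family satisfying the MULTIPLIER CLAUSE at level `m` — «`Δ^η_{U₀}↾Ω₀(D^{η*}_{U₀}A − f) = Q′_m(U₀)ᵀμ` on `Ω₀` for some `μ`», i.e.
`R_m(U₀)(D^{η*}A − f) = 0`, the first conjunct of `B8LanF146.LanF146` and the second of `B8Eq138LandauZd.IsLandau146` — the bond field `G(U₀)(D R_m(U₀) D^{η*}A) =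
G(U₀)(D R_m(U₀) f)` (the letters `Gop`, `DRDs`) is uniformly bounded, and its (1.59) lines 1, 2, 4 (the consumer's collar ∕ gradient ∕ Laplacian norms at level `m`)
are at most `c_S·|f|₍₋₂₎`, `|f|₍₋₂₎ = sup_{j ≤ k} sup_{x ∈ Ω_j}(Lʲη)²|f(x)|` the consumer's site-indexed norm at the member's top level `k`.  (A bound of
`|DRD*A|₍₋₃₎` itself by `|f|₍₋₂₎` would be FALSE for print's objects — a source in `R(U₀)` is not smooth.) [cite: Balaban1985RegularSpaces, (1.146) p.101, Thm 8 p.101, p.92 (|Rf| ≤ B′₀|f|), (1.58)–(1.59) p.86; Balaban1985BackgroundPropagators, (3.20)–(3.27) pp.394–395, (3.42), (3.47) p.398, Thm 3.3 p.399] -/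
def SourceTermDom (ops : ℝ → ZdIdx d L → ℕ → OpsZd d 𝔸) (c35 M₃ a₃ cS : ℝ) : Prop :=
  ∀ (M : ℝ) (i : ZdIdx d L) (m : ℕ), M₃ ≤ M →
    ∀ (α₀ : ℝ) (U₀ : Site d → Fin d → 𝔸ˣ) (hU₀ : ∀ x κ, U₀ x κ ∈ unitaryUnits 𝔸), 0 < α₀ → M * α₀ ≤ a₃ →
      (bg (mem M i m)).Reg335 c35 α₀ (ιCfg M i m U₀ hU₀) →
      ∀ A : Site d → Fin d → 𝔸, OnDom L m i.η i.Ω A →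
      ∀ f : Site d → 𝔸, Bdd L i.k i.η (-(2 : ℝ)) (fun j (x : Site d) => x ∈ i.Ω j) f →
        (∃ μ : ℕ → Site d → 𝔸, ∀ x ∈ i.Ω 0,
          covLap i.η U₀ ((i.Ω 0).indicator (covDivB i.η U₀ A - f)) x = QT L m (i.Λs m) U₀ μ x) →
        (∃ C : ℝ, ∀ (y : Site d) (τ : Fin d), ‖(ops M i m).Gop U₀ (fun z κ => (ops M i m).DRDs U₀ A z κ) y τ‖ ≤ C) ∧
        msup L m i.η (-(1 : ℝ)) (fun j (b : Site d × Fin d) => SideTouches (i.Ω j) b.1 b.2)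
            (fun b => (ops M i m).Gop U₀ (fun z κ => (ops M i m).DRDs U₀ A z κ) b.1 b.2) ≤
          cS * msup L i.k i.η (-(2 : ℝ)) (fun j (x : Site d) => x ∈ i.Ω j) f ∧
        msup L m i.η (-(2 : ℝ)) (fun j (t : Fin d × Fin d × Site d) => SideTouches (i.Ω j) t.2.2 t.2.1)
            (fun t => covDerivFwd i.η U₀ t.1 (fun z => (ops M i m).Gop U₀ (fun z κ => (ops M i m).DRDs U₀ A z κ) z t.2.1) t.2.2) ≤
          cS * msup L i.k i.η (-(2 : ℝ)) (fun j (x : Site d) => x ∈ i.Ω j) f ∧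
        bondNorm L m i.η (-(3 : ℝ)) i.Ω
            (fun x μ => covLap i.η U₀ (fun z => (ops M i m).Gop U₀ (fun z κ => (ops M i m).DRDs U₀ A z κ) z μ) x) ≤
          cS * msup L i.k i.η (-(2 : ℝ)) (fun j (x : Site d) => x ∈ i.Ω j) f

/-- **THE HÖLDER LINE OF THE SOURCE TERM** (B8 p. 101 «the constants B₁, B₂(β₀) are as in Theorems 2, 4» — Theorem 8 keeps the Hölder member (1.39); [4]
(3.43) for the `G∇*`-type entry): under the hypotheses of `SourceTermDom`, the weighted β-Hölder functional of `∇_{U₀}G(U₀)(D R_m D^{η*}A)` (the consumer's fifth line,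
exponent `β`, length function `len`) has a bounded family and is at most `c_Sβ·|f|₍₋₂₎`. [cite: Balaban1985RegularSpaces, Thm 8 p.101, (1.39) p.82, (1.59) p.86; Balaban1985BackgroundPropagators, (3.43) p.398, (3.40) p.397] -/
def SourceHolderDom (ops : ℝ → ZdIdx d L → ℕ → OpsZd d 𝔸) (c35 M₃ a₃ : ℝ) (β : ℝ) (len : Site d → ℝ) (cSβ : ℝ) : Prop :=
  ∀ (M : ℝ) (i : ZdIdx d L) (m : ℕ), M₃ ≤ M →
    ∀ (α₀ : ℝ) (U₀ : Site d → Fin d → 𝔸ˣ) (hU₀ : ∀ x κ, U₀ x κ ∈ unitaryUnits 𝔸), 0 < α₀ → M * α₀ ≤ a₃ →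
      (bg (mem M i m)).Reg335 c35 α₀ (ιCfg M i m U₀ hU₀) →
      ∀ A : Site d → Fin d → 𝔸, OnDom L m i.η i.Ω A →
      ∀ f : Site d → 𝔸, Bdd L i.k i.η (-(2 : ℝ)) (fun j (x : Site d) => x ∈ i.Ω j) f →
        (∃ μ : ℕ → Site d → 𝔸, ∀ x ∈ i.Ω 0,
          covLap i.η U₀ ((i.Ω 0).indicator (covDivB i.η U₀ A - f)) x = QT L m (i.Λs m) U₀ μ x) →
        Bdd L m i.η (-(2 + β)) (fun j (q : Fin d × Fin d × (Site d × Site d)) => q.2.2 ∈ AdmPair i.η len ∧ q.2.2.1 ∈ i.Ω j)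
            (fun q => hquot i.η β len U₀
              (covDerivFwd i.η U₀ q.1 (fun z => (ops M i m).Gop U₀ (fun z κ => (ops M i m).DRDs U₀ A z κ) z q.2.1)) q.2.2) ∧
        msup L m i.η (-(2 + β)) (fun j (q : Fin d × Fin d × (Site d × Site d)) => q.2.2 ∈ AdmPair i.η len ∧ q.2.2.1 ∈ i.Ω j)
            (fun q => hquot i.η β len U₀
              (covDerivFwd i.η U₀ q.1 (fun z => (ops M i m).Gop U₀ (fun z κ => (ops M i m).DRDs U₀ A z κ) z q.2.1)) q.2.2) ≤
          cSβ * msup L i.k i.η (-(2 : ℝ)) (fun j (x : Site d) => x ∈ i.Ω j) f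

end Binders

/-! ## §2 Bookkeeping: junk values, subadditivity, the clause's locality, the a-priori arithmetic with a source -/

section Bookkeeping

/-- r05's junk value: an UNBOUNDED weighted family has `msup = 0` (real `iSup` convention). [cite: Balaban1985RegularSpaces, p.86 (definition after (1.55))] -/
theorem msup_eq_zero_of_not_bdd {ι E : Type*} [SeminormedAddCommGroup E] {L k : ℕ} {η α : ℝ} {mem : ℕ → ι → Prop} {F : ι → E}
    (h : ¬ Bdd L k η α mem F) : msup L k η α mem F = 0 := by
  unfold msup
  refine Real.iSup_of_not_bddAbove fun hb => h ?_
  obtain ⟨c, hc⟩ := hb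
  exact ⟨c, fun j hj i hi => hc ⟨⟨(j, i), hj, hi⟩, rfl⟩⟩

/-- Subadditivity of the p. 86 norm along a pointwise norm splitting `‖H‖ ≤ ‖F‖ + ‖G‖` (bounded summands). [cite: Balaban1985RegularSpaces, p.86 (definition after (1.55))] -/
theorem msup_le_add_of_norm_le {ι E₁ E₂ E₃ : Type*} [SeminormedAddCommGroup E₁] [SeminormedAddCommGroup E₂] [SeminormedAddCommGroup E₃]
    {L k : ℕ} {η : ℝ} (hη : 0 ≤ η) {α : ℝ} {mem : ℕ → ι → Prop} {H : ι → E₁} {F : ι → E₂} {G : ι → E₃}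
    (hle : ∀ i, ‖H i‖ ≤ ‖F i‖ + ‖G i‖) (hF : Bdd L k η α mem F) (hG : Bdd L k η α mem G) :
    msup L k η α mem H ≤ msup L k η α mem F + msup L k η α mem G := by
  refine B8ScaledSupNorm.msup_le (add_nonneg (B8ScaledSupNorm.msup_nonneg L k hη α mem F) (B8ScaledSupNorm.msup_nonneg L k hη α mem G))
    fun j hj i hi => ?_
  have hw : 0 ≤ weight L η α j := B8ScaledSupNorm.weight_nonneg L hη α j
  calc weight L η α j * ‖H i‖ ≤ weight L η α j * (‖F i‖ + ‖G i‖) := mul_le_mul_of_nonneg_left (hle i) hw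
    _ = weight L η α j * ‖F i‖ + weight L η α j * ‖G i‖ := mul_add _ _ _
    _ ≤ _ := add_le_add (B8ScaledSupNorm.weight_mul_norm_le_msup hF hj hi) (B8ScaledSupNorm.weight_mul_norm_le_msup hG hj hi)

/-- `R(U₀(Γ))` is additive. [cite: Balaban1985Averaging, (56)–(57) p.27] -/
theorem trans_add (U₀ : Site d → Fin d → 𝔸ˣ) (x x' : Site d) (X Y : 𝔸) :
    trans U₀ x x' (X + Y) = trans U₀ x x' X + trans U₀ x x' Y := by
  rw [B9Eq340HolderZd.trans_def, B9Eq340HolderZd.trans_def, B9Eq340HolderZd.trans_def, B7Eq78Linearization.conjR_add]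

/-- The Hölder quotient (3.40) is subadditive in the function: `hquot(F + G) ≤ hquot F + hquot G` on admissible pairs. [cite: Balaban1985BackgroundPropagators, (3.40) p.397] -/
theorem hquot_add_le {η : ℝ} (hη : 0 ≤ η) (β : ℝ) {len : Site d → ℝ} (U₀ : Site d → Fin d → 𝔸ˣ) (F G : Site d → 𝔸) {p : Site d × Site d}
    (hp : p ∈ AdmPair η len) : hquot η β len U₀ (F + G) p ≤ hquot η β len U₀ F p + hquot η β len U₀ G p := by
  simp only [B9Eq340HolderZd.hquot_def, Pi.add_apply, trans_add, ← add_div]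
  refine div_le_div_of_nonneg_right ?_ (Real.rpow_nonneg (mul_nonneg hη hp.1.le) β)
  calc ‖trans U₀ p.1 p.2 (F p.2) + trans U₀ p.1 p.2 (G p.2) - (F p.1 + G p.1)‖
      = ‖(trans U₀ p.1 p.2 (F p.2) - F p.1) + (trans U₀ p.1 p.2 (G p.2) - G p.1)‖ := by congr 1; abel
    _ ≤ _ := norm_add_le _ _

/-- `hquot(F − G) ≤ hquot F + hquot G` on admissible pairs. [cite: Balaban1985BackgroundPropagators, (3.40) p.397] -/
theorem hquot_sub_le {η : ℝ} (hη : 0 ≤ η) (β : ℝ) {len : Site d → ℝ} (U₀ : Site d → Fin d → 𝔸ˣ) (F G : Site d → 𝔸) {p : Site d × Site d}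
    (hp : p ∈ AdmPair η len) : hquot η β len U₀ (F - G) p ≤ hquot η β len U₀ F p + hquot η β len U₀ G p := by
  simp only [B9Eq340HolderZd.hquot_def, Pi.sub_apply, B9Eq340HolderZd.trans_sub, ← add_div]
  refine div_le_div_of_nonneg_right ?_ (Real.rpow_nonneg (mul_nonneg hη hp.1.le) β)
  calc ‖trans U₀ p.1 p.2 (F p.2) - trans U₀ p.1 p.2 (G p.2) - (F p.1 - G p.1)‖
      = ‖(trans U₀ p.1 p.2 (F p.2) - F p.1) - (trans U₀ p.1 p.2 (G p.2) - G p.1)‖ := by congr 1; abel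
    _ ≤ _ := norm_sub_le _ _

/-- **The multiplier clause reads `A` on the bonds of `Ω₀` only** (as `IsLandau138`∕`IsLandau146`: `B8Eq138LandauZd.isLandau146_congr`).
[cite: Balaban1985RegularSpaces, (1.146) p.101, p.77 (bond convention)] -/
theorem mulClause_congr {L m : ℕ} {η : ℝ} {Ω₀ : Set (Site d)} {Λs : ℕ → Set (Site d)} {U₀ : Site d → Fin d → 𝔸ˣ} (f : Site d → 𝔸)
    {A A' : Site d → Fin d → 𝔸} (h : ∀ (x : Site d) (μ : Fin d), BondTouches Ω₀ x μ → A x μ = A' x μ) :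
    (∃ μ : ℕ → Site d → 𝔸, ∀ x ∈ Ω₀, covLap η U₀ (Ω₀.indicator (covDivB η U₀ A - f)) x = QT L m Λs U₀ μ x) ↔
      (∃ μ : ℕ → Site d → 𝔸, ∀ x ∈ Ω₀, covLap η U₀ (Ω₀.indicator (covDivB η U₀ A' - f)) x = QT L m Λs U₀ μ x) := by
  have hind : Ω₀.indicator (covDivB η U₀ A - f) = Ω₀.indicator (covDivB η U₀ A' - f) := by
    funext x
    by_cases hx : x ∈ Ω₀
    · rw [Set.indicator_of_mem hx, Set.indicator_of_mem hx, Pi.sub_apply, Pi.sub_apply]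
      congr 1
      refine B8Eq138LandauZd.covDivB_congr η U₀ fun μ => ⟨h _ _ (Or.inr ?_), h _ _ (Or.inl hx)⟩
      simpa using hx
    · rw [Set.indicator_of_notMem hx, Set.indicator_of_notMem hx]
  rw [hind]

/-- **THE NEUMANN ARITHMETIC OF (1.59) WITH AN ADDITIVE SOURCE**: if the reduced source obeys `N ≤ |J| + κ′a + q|B₁|`, the entries obey `a, g, l ≤ B₀N + S`,
`h ≤ C_βN + S_h` and `B₀κ′ ≤ ½`, then `a, g, l ≤ B₀′(|J| + |B₁|) + 2S`, `|J| ≤ B₀′(|J| + |B₁|)`, `h ≤ 2C_βmax{1,q}(|J| + |B₁|) + (C_βS∕B₀ + S_h)`, B₀′ = max{1, 2B₀max{1,q}}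
(print p. 101: «only some constants change their numerical values»). [cite: Balaban1985RegularSpaces, (1.59)–(1.60) p.86, Thm 8 p.101] -/
theorem apriori_arith_src {a g l h nJ nB N B₀ κ' q Cβ S Sh : ℝ} (hB₀ : 0 < B₀) (hq : 0 ≤ q) (hκ' : 0 ≤ κ') (hθ : B₀ * κ' ≤ 1 / 2)
    (ha0 : 0 ≤ a) (hnJ : 0 ≤ nJ) (hnB : 0 ≤ nB) (hCβ : 0 ≤ Cβ) (hS : 0 ≤ S)
    (hN : N ≤ nJ + κ' * a + q * nB) (h1 : a ≤ B₀ * N + S) (h2 : g ≤ B₀ * N + S) (h4 : l ≤ B₀ * N + S) (h5 : h ≤ Cβ * N + Sh) :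
    a ≤ max 1 (2 * B₀ * max 1 q) * (nJ + nB) + 2 * S ∧ g ≤ max 1 (2 * B₀ * max 1 q) * (nJ + nB) + 2 * S ∧
      nJ ≤ max 1 (2 * B₀ * max 1 q) * (nJ + nB) ∧ l ≤ max 1 (2 * B₀ * max 1 q) * (nJ + nB) + 2 * S ∧
      h ≤ 2 * Cβ * max 1 q * (nJ + nB) + (Cβ * S / B₀ + Sh) := by
  have hX : 0 ≤ nJ + q * nB := by positivity
  have hsum : 0 ≤ nJ + nB := add_nonneg hnJ hnB
  have hθa : B₀ * κ' * a ≤ 1 / 2 * a := mul_le_mul_of_nonneg_right hθ ha0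
  have haN : a ≤ B₀ * (nJ + κ' * a + q * nB) + S := h1.trans (by nlinarith [mul_le_mul_of_nonneg_left hN hB₀.le])
  have ha : a ≤ 2 * B₀ * (nJ + q * nB) + 2 * S := by nlinarith
  -- κ′a ≤ (|J| + q|B₁|) + 2κ′S and N ≤ 2(|J| + q|B₁|) + 2κ′S
  have hκa : κ' * a ≤ κ' * (2 * B₀ * (nJ + q * nB) + 2 * S) := mul_le_mul_of_nonneg_left ha hκ'
  have hκX : κ' * (2 * B₀ * (nJ + q * nB)) ≤ 1 * (nJ + q * nB) := by nlinarith
  have hN2 : N ≤ 2 * (nJ + q * nB) + 2 * (κ' * S) := by nlinarith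
  have hmq : nJ + q * nB ≤ max 1 q * (nJ + nB) := by
    have h₁ : 1 * nJ ≤ max 1 q * nJ := mul_le_mul_of_nonneg_right (le_max_left 1 q) hnJ
    have h₂ : q * nB ≤ max 1 q * nB := mul_le_mul_of_nonneg_right (le_max_right 1 q) hnB
    linarith
  have hκS : B₀ * (κ' * S) ≤ 1 / 2 * S := by nlinarith
  have hB' : 2 * B₀ * max 1 q * (nJ + nB) ≤ max 1 (2 * B₀ * max 1 q) * (nJ + nB) :=
    mul_le_mul_of_nonneg_right (le_max_right _ _) hsum
  have h1' : 1 * (nJ + nB) ≤ max 1 (2 * B₀ * max 1 q) * (nJ + nB) := mul_le_mul_of_nonneg_right (le_max_left _ _) hsum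
  have hma : 2 * B₀ * (nJ + q * nB) ≤ 2 * B₀ * (max 1 q * (nJ + nB)) := mul_le_mul_of_nonneg_left hmq (by positivity)
  have hgN : B₀ * N ≤ B₀ * (2 * (nJ + q * nB) + 2 * (κ' * S)) := mul_le_mul_of_nonneg_left hN2 hB₀.le
  have hhN : Cβ * N ≤ Cβ * (2 * (nJ + q * nB) + 2 * (κ' * S)) := mul_le_mul_of_nonneg_left hN2 hCβ
  have hCq : Cβ * (2 * (nJ + q * nB)) ≤ Cβ * (2 * (max 1 q * (nJ + nB))) := mul_le_mul_of_nonneg_left (by linarith) hCβ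
  -- 2C_βκ′S ≤ C_βS∕B₀ (κ′ ≤ 1∕(2B₀))
  have hκ'le : κ' ≤ 1 / (2 * B₀) := by
    rw [le_div_iff₀ (by positivity)]; linarith
  have hCS : Cβ * (2 * (κ' * S)) ≤ Cβ * S / B₀ := by
    have h0 : 0 ≤ Cβ * S := mul_nonneg hCβ hS
    calc Cβ * (2 * (κ' * S)) = 2 * κ' * (Cβ * S) := by ring
      _ ≤ 2 * (1 / (2 * B₀)) * (Cβ * S) := mul_le_mul_of_nonneg_right (by linarith) h0
      _ = Cβ * S / B₀ := by field_simp
  refine ⟨by linarith, by linarith, by linarith, by linarith, by linarith⟩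

end Bookkeeping

/-! ## §3 The sourced junction at one member with `Ω₀ = ℤᵈ` -/

section Supply

variable [Nontrivial 𝔸]
variable {I : Type} (geo : I → B9.Geometry) (bg : I → B9.Backgrounds) (GA : ∀ i, B9.KernelFamily (geo i) (bg i))
variable (L : ℕ) (mem : ℝ → ZdIdx d L → ℕ → I)
variable (ιCfg : ∀ (M : ℝ) (i : ZdIdx d L) (m : ℕ) (U₀ : Site d → Fin d → 𝔸ˣ),
  (∀ x κ, U₀ x κ ∈ unitaryUnits 𝔸) → (bg (mem M i m)).Cfg)
variable (ιLoc : ∀ (M : ℝ) (i : ZdIdx d L) (m : ℕ), (Site d → Fin d → 𝔸) → (geo (mem M i m)).Loc)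
variable (ops : ℝ → ZdIdx d L → ℕ → OpsZd d 𝔸)

-- budget line (ops-buildfix standing ask for 100+-line weighted-norm proofs; elaborates well inside the default today)
set_option maxHeartbeats 400000 in
/-- ★ **THE SOURCED JUNCTION AT A MEMBER WITH `Ω₀ = ℤᵈ`** (B8 Theorem 8's frame, p. 101: (1.58)–(1.59) with the gauge condition (1.146)): Theorem 3.3's two blocks
at `(M, i, m)` + `DictGlob` + `Prop6Feed` + `InvOnDom`∕`CurvSmallDom`∕`AvgBoundDom`∕`HolderGlob` + `GopAdd`∕`SourceTermDom`∕`SourceHolderDom` give, for every datum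
— `0 < α₀, α₂ ≤ cP`, `U₀ ∈ 𝔄_m` unitary-valued, a bond field `A′` with (1.41) `‖A′‖ ≤ α₂(Lʲη)⁻¹` on the sides of the plaquettes touching `Ω_j` (`j ≤ m`) and `A′ = 0` off
them, a source `f` with bounded `(Lʲη)²`-family and the multiplier clause «`R_m(U₀)(D^{η*}_{U₀}A′ − f) = 0`» — the five (1.59) lines: `|A′|₍₋₁₎, |∇A′|₍₋₂₎, |ΔA′|₍₋₃₎ ≤
B₀′(|J|₍₋₃₎ + |B₁|) + 2c_S|f|₍₋₂₎`, `|D*DA′|₍₋₃₎ ≤ B₀′(|J|₍₋₃₎ + |B₁|)`, Hölder `≤ B₀β′(|J|₍₋₃₎ + |B₁|) + (C_βc_S∕B₀ + c_Sβ)|f|₍₋₂₎`, with B₀′ = max{1, 2B₀max{1,q}},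
B₀β′ = 2C_βmax{1,q}, C_β = max{0, C_H Bβ(β)}, cP as in `B9SupplySockB9P3ZdOmega`.  Proof: `A′ ∈ E(Ω₀)` (every bond is a bond of `Ω₀`); `Δ_aA′ = J̃₁ + DRD*A′`,
`J̃₁ = J + Δ′A′ + Q*aQA′`; (1.58) + additivity: `G(U₀)J̃₁ = A′ − G(U₀)DRD*A′`; (3.69)∕(3.16): `|J̃₁|₍₋₃₎ ≤ |J|₍₋₃₎ + c₆₉MK₆α₀|A′|₍₋₁₎ + q|B₁|`; the frame's
(3.47)@−3 entries and `HolderGlob` bound the lines of `A′ − G(U₀)DRD*A′`, `SourceTermDom`∕`SourceHolderDom` those of `G(U₀)DRD*A′`; `apriori_arith_src`.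
[cite: Balaban1985RegularSpaces, Thm 8 + (1.146) p.101, (1.58)–(1.59) p.86, Prop. 3 p.87, p.92; Balaban1985BackgroundPropagators, Thm 3.3 p.399, (3.20)–(3.27) pp.394–395, (3.43), (3.47) p.398, (3.69) p.404] -/
theorem sockSrc_core_at_univ (hL : 1 ≤ L) {c35 c₆ K₆ M₃ a₃ c69 q CH β cS cSβ : ℝ} {len : Site d → ℝ}
    (hdict : DictGlob geo bg GA L mem ιCfg ιLoc ops) (hP6 : Prop6Feed bg L mem ιCfg c35 M₃ c₆ K₆)
    (hinv : InvOnDom bg L mem ιCfg ops c35 M₃ a₃) (hcurv : CurvSmallDom bg L mem ιCfg ops c35 M₃ a₃ c69) (havg : AvgBoundDom L ops q)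
    (hhol : HolderGlob geo bg GA L mem ιCfg ops β len CH) (hadd : GopAdd L ops)
    (hsrc : SourceTermDom bg L mem ιCfg ops c35 M₃ a₃ cS) (hsrcH : SourceHolderDom bg L mem ιCfg ops c35 M₃ a₃ β len cSβ)
    (hK₆ : 0 < K₆) (hc69 : 0 ≤ c69) (hq : 0 ≤ q) (hcS : 0 ≤ cS) (hcSβ : 0 ≤ cSβ)
    {M : ℝ} (hM1 : 1 ≤ M) (hM₃ : M₃ ≤ M) (i : ZdIdx d L) (hΩ : i.Ω 0 = Set.univ) (m : ℕ)
    {B₀ δ₀ a₀ : ℝ} {Bβ Bε : ℝ → ℝ} {Bεβ : ℝ → ℝ → ℝ} (hB₀ : 0 < B₀)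
    (h33U : ∀ (α₀ : ℝ) (U₀ : Site d → Fin d → 𝔸ˣ) (hU₀ : ∀ x κ, U₀ x κ ∈ unitaryUnits 𝔸), 0 < α₀ → M * α₀ ≤ a₀ →
      (bg (mem M i m)).Reg335 c35 α₀ (ιCfg M i m U₀ hU₀) →
      B9.Ineq342_346_347 (GA (mem M i m)) B₀ δ₀ (ιCfg M i m U₀ hU₀) ∧
        B9.Ineq343_345 (GA (mem M i m)) Bβ Bε Bεβ δ₀ (ιCfg M i m U₀ hU₀)) :
    ∀ α₀ α₂ : ℝ, 0 < α₀ →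
      α₀ ≤ min (1 / 16) (min (c₆ / M) (min (a₀ / (K₆ * M)) (min (a₃ / (K₆ * M)) (1 / (2 * B₀ * c69 * K₆ * M + 1))))) →
      0 < α₂ → α₂ ≤ 1 / 16 →
    ∀ (U₀ : Site d → Fin d → 𝔸ˣ), (∀ x κ, U₀ x κ ∈ unitaryUnits 𝔸) → InAk L m i.η α₀ i.Ω U₀ →
    ∀ A' : Site d → Fin d → 𝔸,
    (∀ j, j ≤ m → ∀ (y : Site d) (τ : Fin d), SideTouches (i.Ω j) y τ → ‖A' y τ‖ ≤ α₂ * ((L : ℝ) ^ j * i.η)⁻¹) →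
    (∀ (y : Site d) (τ : Fin d), (∀ j, j ≤ m → ¬ SideTouches (i.Ω j) y τ) → A' y τ = 0) →
    ∀ f : Site d → 𝔸, Bdd L i.k i.η (-(2 : ℝ)) (fun j (x : Site d) => x ∈ i.Ω j) f →
    (∃ μ : ℕ → Site d → 𝔸, ∀ x ∈ i.Ω 0, covLap i.η U₀ ((i.Ω 0).indicator (covDivB i.η U₀ A' - f)) x = QT L m (i.Λs m) U₀ μ x) →
    msup L m i.η (-(1 : ℝ)) (fun j (b : Site d × Fin d) => SideTouches (i.Ω j) b.1 b.2) (fun b => A' b.1 b.2)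
        ≤ max 1 (2 * B₀ * max 1 q) * (bondNorm L m i.η (-(3 : ℝ)) i.Ω (fun x μ => Jcur i.η U₀ A' μ x)
          + wsup 1 (fun p : {p : ℕ × (Site d × Fin d) // p.1 ≤ m ∧ p.2 ∈ i.Λb m p.1} =>
              linCovIter L U₀ (iEta i.η A') p.1.1 p.1.2.1 p.1.2.2))
          + 2 * (cS * msup L i.k i.η (-(2 : ℝ)) (fun j (x : Site d) => x ∈ i.Ω j) f) ∧
      msup L m i.η (-(2 : ℝ)) (fun j (t : Fin d × Fin d × Site d) => SideTouches (i.Ω j) t.2.2 t.2.1)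
          (fun t => covDerivFwd i.η U₀ t.1 (fun z => A' z t.2.1) t.2.2)
        ≤ max 1 (2 * B₀ * max 1 q) * (bondNorm L m i.η (-(3 : ℝ)) i.Ω (fun x μ => Jcur i.η U₀ A' μ x)
          + wsup 1 (fun p : {p : ℕ × (Site d × Fin d) // p.1 ≤ m ∧ p.2 ∈ i.Λb m p.1} =>
              linCovIter L U₀ (iEta i.η A') p.1.1 p.1.2.1 p.1.2.2))
          + 2 * (cS * msup L i.k i.η (-(2 : ℝ)) (fun j (x : Site d) => x ∈ i.Ω j) f) ∧
      bondNorm L m i.η (-(3 : ℝ)) i.Ω (fun x μ => pdiv i.η U₀ (plaqCovDeriv i.η U₀ A') μ x)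
        ≤ max 1 (2 * B₀ * max 1 q) * (bondNorm L m i.η (-(3 : ℝ)) i.Ω (fun x μ => Jcur i.η U₀ A' μ x)
          + wsup 1 (fun p : {p : ℕ × (Site d × Fin d) // p.1 ≤ m ∧ p.2 ∈ i.Λb m p.1} =>
              linCovIter L U₀ (iEta i.η A') p.1.1 p.1.2.1 p.1.2.2)) ∧
      bondNorm L m i.η (-(3 : ℝ)) i.Ω (fun x μ => covLap i.η U₀ (fun z => A' z μ) x)
        ≤ max 1 (2 * B₀ * max 1 q) * (bondNorm L m i.η (-(3 : ℝ)) i.Ω (fun x μ => Jcur i.η U₀ A' μ x)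
          + wsup 1 (fun p : {p : ℕ × (Site d × Fin d) // p.1 ≤ m ∧ p.2 ∈ i.Λb m p.1} =>
              linCovIter L U₀ (iEta i.η A') p.1.1 p.1.2.1 p.1.2.2))
          + 2 * (cS * msup L i.k i.η (-(2 : ℝ)) (fun j (x : Site d) => x ∈ i.Ω j) f) ∧
      msup L m i.η (-(2 + β)) (fun j (q : Fin d × Fin d × (Site d × Site d)) => q.2.2 ∈ AdmPair i.η len ∧ q.2.2.1 ∈ i.Ω j)
          (fun q => hquot i.η β len U₀ (covDerivFwd i.η U₀ q.1 (fun z => A' z q.2.1)) q.2.2)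
        ≤ 2 * max 0 (CH * Bβ β) * max 1 q * (bondNorm L m i.η (-(3 : ℝ)) i.Ω (fun x μ => Jcur i.η U₀ A' μ x)
          + wsup 1 (fun p : {p : ℕ × (Site d × Fin d) // p.1 ≤ m ∧ p.2 ∈ i.Λb m p.1} =>
              linCovIter L U₀ (iEta i.η A') p.1.1 p.1.2.1 p.1.2.2))
          + (max 0 (CH * Bβ β) * (cS * msup L i.k i.η (-(2 : ℝ)) (fun j (x : Site d) => x ∈ i.Ω j) f) / B₀
            + cSβ * msup L i.k i.η (-(2 : ℝ)) (fun j (x : Site d) => x ∈ i.Ω j) f) := by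
  intro α₀ α₂ hα₀ hα₀c hα₂ hα₂16 U₀ hU₀ hInA A' h41 hA0 f hfB hcl
  -- the thresholds
  have hη : 0 < i.η := i.hη
  have hLr : (1 : ℝ) ≤ L := by exact_mod_cast hL
  have hM0 : 0 < M := lt_of_lt_of_le one_pos hM1
  have hKM : 0 < K₆ * M := mul_pos hK₆ hM0
  simp only [le_min_iff] at hα₀c
  obtain ⟨-, hα₀c6, hα₀a0, hα₀a3, hα₀θ⟩ := hα₀c
  have hc6 : M * α₀ ≤ c₆ := by rw [mul_comm]; exact (le_div_iff₀ hM0).1 hα₀c6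
  have ha₉0 : 0 < K₆ * α₀ := mul_pos hK₆ hα₀
  have ha0' : M * (K₆ * α₀) ≤ a₀ := by
    have h := (le_div_iff₀ hKM).1 hα₀a0
    calc M * (K₆ * α₀) = α₀ * (K₆ * M) := by ring
      _ ≤ a₀ := h
  have ha3' : M * (K₆ * α₀) ≤ a₃ := by
    have h := (le_div_iff₀ hKM).1 hα₀a3
    calc M * (K₆ * α₀) = α₀ * (K₆ * M) := by ring
      _ ≤ a₃ := h
  have hκ' : 0 ≤ c69 * M * (K₆ * α₀) := by positivity
  have hθ : B₀ * (c69 * M * (K₆ * α₀)) ≤ 1 / 2 := by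
    have hpos : 0 < 2 * B₀ * c69 * K₆ * M + 1 := by positivity
    have h1 : α₀ * (2 * B₀ * c69 * K₆ * M + 1) ≤ 1 := (le_div_iff₀ hpos).1 hα₀θ
    linarith [hα₀.le]
  -- (3.35) for U₀ by Proposition 6, and Theorem 3.3's blocks for G(U₀)
  have hreg : (bg (mem M i m)).Reg335 c35 (K₆ * α₀) (ιCfg M i m U₀ hU₀) := hP6 M i m hM₃ α₀ U₀ hU₀ hα₀ hc6 hInA
  obtain ⟨h347, h345⟩ := h33U (K₆ * α₀) U₀ hU₀ ha₉0 ha0' hreg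
  obtain ⟨-, hd⟩ := hdict M i m
  -- A′ ∈ E(Ω₀) (every bond is a bond of Ω₀ = ℤᵈ); A′ uniformly bounded
  have hU₀1 : ∀ x κ, U₀ x κ ∈ U1 𝔸 := fun x κ => unitaryUnits_le_U1 (hU₀ x κ)
  have hBT : ∀ (y : Site d) (τ : Fin d), BondTouches (i.Ω 0) y τ := fun y τ => Or.inl (by rw [hΩ]; exact Set.mem_univ y)
  have hAbd : Bdd L m i.η (-(1 : ℝ)) (fun j (b : Site d × Fin d) => SideTouches (i.Ω j) b.1 b.2) (fun b => A' b.1 b.2) := by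
    have e1 : (-(1 : ℝ)) = -((1 : ℕ) : ℝ) := by norm_num
    rw [e1]
    refine B8ScaledSupNorm.bdd_of_forall (c := α₂) fun j hj b hb => ?_
    rw [B8ScaledSupNorm.weight_neg_natCast, pow_one]
    have h := h41 j hj b.1 b.2 hb
    have hs : 0 < (L : ℝ) ^ j * i.η := B8ScaledSupNorm.scale_pos hL hη j
    calc (L : ℝ) ^ j * i.η * ‖A' b.1 b.2‖ ≤ (L : ℝ) ^ j * i.η * (α₂ * ((L : ℝ) ^ j * i.η)⁻¹) :=
          mul_le_mul_of_nonneg_left h hs.le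
      _ = α₂ := by rw [mul_comm α₂, ← mul_assoc, mul_inv_cancel₀ hs.ne', one_mul]
  have hOn : OnDom L m i.η i.Ω A' := ⟨fun y τ h => absurd (hBT y τ) h, hAbd⟩
  have hAglob : ∀ (y : Site d) (τ : Fin d), ‖A' y τ‖ ≤ α₂ * i.η⁻¹ := by
    intro y τ
    by_cases hmem : ∃ j, j ≤ m ∧ SideTouches (i.Ω j) y τ
    · obtain ⟨j, hj, hs⟩ := hmem
      have hLj : (1 : ℝ) ≤ (L : ℝ) ^ j := one_le_pow₀ hLr
      calc ‖A' y τ‖ ≤ α₂ * ((L : ℝ) ^ j * i.η)⁻¹ := h41 j hj y τ hs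
        _ = α₂ * i.η⁻¹ * ((L : ℝ) ^ j)⁻¹ := by rw [mul_inv]; ring
        _ ≤ α₂ * i.η⁻¹ * 1 := by
            apply mul_le_mul_of_nonneg_left (inv_le_one_of_one_le₀ hLj) (by positivity)
        _ = α₂ * i.η⁻¹ := mul_one _
    · rw [hA0 y τ fun j hj hs => hmem ⟨j, hj, hs⟩, norm_zero]
      positivity
  obtain ⟨a, ha_def⟩ : ∃ a : ℝ,
      a = msup L m i.η (-(1 : ℝ)) (fun j (b : Site d × Fin d) => SideTouches (i.Ω j) b.1 b.2) (fun b => A' b.1 b.2) := ⟨_, rfl⟩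
  have ha0 : 0 ≤ a := by rw [ha_def]; exact B8ScaledSupNorm.msup_nonneg L m hη.le _ _ _
  -- the sources: J̃₁ = J + Δ′A′ + Q*aQA′ and the (1.146) term S = DRD*A′; Δ_aA′ = J̃₁ + S; (1.58) + additivity
  obtain ⟨Jt, hJt_def⟩ : ∃ Jt : Site d → Fin d → 𝔸,
      Jt = fun x μ => Jcur i.η U₀ A' μ x + (ops M i m).Dp U₀ A' x μ + (ops M i m).QQ U₀ A' x μ := ⟨_, rfl⟩
  obtain ⟨S, hS_def⟩ : ∃ S : Site d → Fin d → 𝔸, S = fun x μ => (ops M i m).DRDs U₀ A' x μ := ⟨_, rfl⟩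
  have hGJS : (ops M i m).Gop U₀ (Jt + S) = A' := by
    refine hinv M i m hM₃ (K₆ * α₀) U₀ hU₀ ha₉0 ha3' hreg A' hOn (Jt + S) fun y τ _ => ?_
    rw [hJt_def, hS_def]
    simp only [Pi.add_apply, deltaAOf]
    abel
  obtain ⟨GS, hGS_def⟩ : ∃ GS : Site d → Fin d → 𝔸, GS = (ops M i m).Gop U₀ S := ⟨_, rfl⟩
  have hGJ : (ops M i m).Gop U₀ Jt = A' - GS := by
    rw [hGS_def, eq_sub_iff_add_eq, ← hadd, hGJS]
  -- the source binder at (A′, f)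
  obtain ⟨⟨C, hC⟩, hS1, hS2, hS4⟩ := hsrc M i m hM₃ (K₆ * α₀) U₀ hU₀ ha₉0 ha3' hreg A' hOn f hfB hcl
  obtain ⟨hSbdd, hS5⟩ := hsrcH M i m hM₃ (K₆ * α₀) U₀ hU₀ ha₉0 ha3' hreg A' hOn f hfB hcl
  rw [← hS_def, ← hGS_def] at hC hS1 hS2 hS4 hSbdd hS5
  obtain ⟨F, hF_def⟩ : ∃ F : ℝ, F = msup L i.k i.η (-(2 : ℝ)) (fun j (x : Site d) => x ∈ i.Ω j) f := ⟨_, rfl⟩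
  have hF0 : 0 ≤ F := by rw [hF_def]; exact B8ScaledSupNorm.msup_nonneg L i.k hη.le _ _ _
  rw [← hF_def] at hS1 hS2 hS4 hS5
  -- the right-hand side quantities: |J|₍₋₃₎ and |B₁|
  obtain ⟨nJ, hnJ_def⟩ : ∃ nJ : ℝ, nJ = bondNorm L m i.η (-(3 : ℝ)) i.Ω (fun x μ => Jcur i.η U₀ A' μ x) := ⟨_, rfl⟩
  obtain ⟨nB, hnB_def⟩ : ∃ nB : ℝ, nB = wsup 1 (fun p : {p : ℕ × (Site d × Fin d) // p.1 ≤ m ∧ p.2 ∈ i.Λb m p.1} =>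
      linCovIter L U₀ (iEta i.η A') p.1.1 p.1.2.1 p.1.2.2) := ⟨_, rfl⟩
  have hnJ0 : 0 ≤ nJ := by rw [hnJ_def]; exact B8ScaledSupNorm.msup_nonneg L m hη.le _ _ _
  have hnB0 : 0 ≤ nB := by rw [hnB_def]; exact B8Eq155JBound.wsup_nonneg zero_le_one _
  -- J is bounded (A′ is)
  have hgrad : ∀ (y : Site d) (κ τ : Fin d), ‖covDerivFwd i.η U₀ κ (fun z => A' z τ) y‖ ≤ i.η⁻¹ * (α₂ * i.η⁻¹ + α₂ * i.η⁻¹) :=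
    fun y κ τ => (B9SupplySockB9P3ZdLettersOmega.norm_covDerivFwd_le hη (hU₀1 _ _) _).trans
      (mul_le_mul_of_nonneg_left (add_le_add (hAglob _ _) (hAglob _ _)) (inv_nonneg.mpr hη.le))
  have hJbd : Bdd L m i.η (-(3 : ℝ)) (fun j (b : Site d × Fin d) => BondTouches (i.Ω j) b.1 b.2)
      (fun b => Jcur i.η U₀ A' b.2 b.1) :=
    B9SupplySockB9P3Zd.bdd_neg_three_of_pointwise hL hη fun b => B9SupplySockB9P3Zd.norm_Jcur_le_of_grad hη hU₀1 hgrad b.2 b.1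
  -- |J̃₁|₍₋₃₎ ≤ |J|₍₋₃₎ + c₆₉ M α₀ |A′|₍₋₁₎ + q |B₁| ((3.69), (3.16))
  have hJt : bondNorm L m i.η (-(3 : ℝ)) i.Ω Jt ≤ nJ + c69 * M * (K₆ * α₀) * a + q * nB := by
    have e3 : (-(3 : ℝ)) = -((3 : ℕ) : ℝ) := by norm_num
    refine B8ScaledSupNorm.msup_le (by positivity) fun j hj b hb => ?_
    have hw : weight L i.η (-(3 : ℝ)) j = ((L : ℝ) ^ j * i.η) ^ 3 := by
      rw [e3, B8ScaledSupNorm.weight_neg_natCast]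
    have hw0 : 0 ≤ ((L : ℝ) ^ j * i.η) ^ 3 := by positivity
    have h1 : weight L i.η (-(3 : ℝ)) j * ‖Jcur i.η U₀ A' b.2 b.1‖ ≤ nJ := by
      rw [hnJ_def]; exact B8ScaledSupNorm.weight_mul_norm_le_msup hJbd hj hb
    have h2 : ((L : ℝ) ^ j * i.η) ^ 3 * ‖(ops M i m).Dp U₀ A' b.1 b.2‖ ≤ c69 * M * (K₆ * α₀) * a := by
      rw [ha_def]; exact hcurv M i m hM₃ (K₆ * α₀) U₀ hU₀ ha₉0 ha3' hreg A' hOn j hj b.1 b.2 hb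
    have h4 : ((L : ℝ) ^ j * i.η) ^ 3 * ‖(ops M i m).QQ U₀ A' b.1 b.2‖ ≤ q * nB := by
      rw [hnB_def]; exact havg M i m U₀ hU₀ A' hOn j hj b.1 b.2 hb
    have hsum : ‖Jt b.1 b.2‖ ≤
        ‖Jcur i.η U₀ A' b.2 b.1‖ + ‖(ops M i m).Dp U₀ A' b.1 b.2‖ + ‖(ops M i m).QQ U₀ A' b.1 b.2‖ := by
      rw [hJt_def]
      exact norm_add₃_le
    rw [hw] at h1 ⊢
    calc ((L : ℝ) ^ j * i.η) ^ 3 * ‖Jt b.1 b.2‖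
        ≤ ((L : ℝ) ^ j * i.η) ^ 3 *
            (‖Jcur i.η U₀ A' b.2 b.1‖ + ‖(ops M i m).Dp U₀ A' b.1 b.2‖ + ‖(ops M i m).QQ U₀ A' b.1 b.2‖) :=
          mul_le_mul_of_nonneg_left hsum hw0
      _ = ((L : ℝ) ^ j * i.η) ^ 3 * ‖Jcur i.η U₀ A' b.2 b.1‖ + ((L : ℝ) ^ j * i.η) ^ 3 * ‖(ops M i m).Dp U₀ A' b.1 b.2‖ +
            ((L : ℝ) ^ j * i.η) ^ 3 * ‖(ops M i m).QQ U₀ A' b.1 b.2‖ := by ring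
      _ ≤ nJ + c69 * M * (K₆ * α₀) * a + q * nB := add_le_add (add_le_add h1 h2) h4
  -- Theorem 3.3's γ = −3 entries at J̃₁ through the dictionary: the lines of A′ − GS
  obtain ⟨N, hN_def⟩ : ∃ N : ℝ, N = bondNorm L m i.η (-(3 : ℝ)) i.Ω Jt := ⟨_, rfl⟩
  rw [← hN_def] at hJt
  obtain ⟨hw, hG0, hG1, hG3⟩ := hd U₀ hU₀ Jt
  have hD1 : msup L m i.η (-(1 : ℝ)) (fun j (b : Site d × Fin d) => SideTouches (i.Ω j) b.1 b.2) (fun b => (A' - GS) b.1 b.2) ≤ B₀ * N := by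
    have h := B9.glob_at_minus_three (GA (mem M i m)) h347 0 (ιLoc M i m Jt)
    rw [hG0, hw, hGJ, ← hN_def] at h
    exact h
  have hD2 : msup L m i.η (-(2 : ℝ)) (fun j (t : Fin d × Fin d × Site d) => SideTouches (i.Ω j) t.2.2 t.2.1)
      (fun t => covDerivFwd i.η U₀ t.1 (fun z => (A' - GS) z t.2.1) t.2.2) ≤ B₀ * N := by
    have h := B9.glob_at_minus_three (GA (mem M i m)) h347 1 (ιLoc M i m Jt)
    rw [hG1, hw, hGJ, ← hN_def] at h
    exact h
  have hD4 : bondNorm L m i.η (-(3 : ℝ)) i.Ω (fun x μ => covLap i.η U₀ (fun z => (A' - GS) z μ) x) ≤ B₀ * N := by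
    have h := B9.glob_at_minus_three (GA (mem M i m)) h347 3 (ιLoc M i m Jt)
    rw [hG3, hw, hGJ, ← hN_def] at h
    exact h
  have hD5 : msup L m i.η (-(2 + β))
      (fun j (q : Fin d × Fin d × (Site d × Site d)) => q.2.2 ∈ AdmPair i.η len ∧ q.2.2.1 ∈ i.Ω j)
      (fun q => hquot i.η β len U₀ (covDerivFwd i.η U₀ q.1 (fun z => (A' - GS) z q.2.1)) q.2.2) ≤ max 0 (CH * Bβ β) * N := by
    have h := hhol M i m Bβ Bε Bεβ δ₀ U₀ hU₀ h345 Jt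
    rw [hGJ, ← hN_def] at h
    exact h.trans (mul_le_mul_of_nonneg_right (le_max_right _ _) (by rw [hN_def]; exact B8ScaledSupNorm.msup_nonneg L m hη.le _ _ _))
  -- splitting A′ = (A′ − GS) + GS in the four local norms (bounded families) and in the Hölder functional (junk-aware)
  have hsplit : ∀ (y : Site d) (τ : Fin d), A' y τ = (A' - GS) y τ + GS y τ := fun y τ => by simp
  have hGSglob : ∀ (y : Site d) (τ : Fin d), ‖GS y τ‖ ≤ C := hC
  have hAGglob : ∀ (y : Site d) (τ : Fin d), ‖(A' - GS) y τ‖ ≤ α₂ * i.η⁻¹ + C := fun y τ => by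
    rw [Pi.sub_apply, Pi.sub_apply]
    exact (norm_sub_le _ _).trans (add_le_add (hAglob y τ) (hC y τ))
  have e1 : (-(1 : ℝ)) = -((1 : ℕ) : ℝ) := by norm_num
  have e2 : (-(2 : ℝ)) = -((2 : ℕ) : ℝ) := by norm_num
  have e3 : (-(3 : ℝ)) = -((3 : ℕ) : ℝ) := by norm_num
  have hL1 : a ≤ B₀ * N + cS * F := by
    rw [ha_def]
    refine (msup_le_add_of_norm_le hη.le (F := fun b : Site d × Fin d => (A' - GS) b.1 b.2) (G := fun b : Site d × Fin d => GS b.1 b.2)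
      (fun b => by rw [hsplit]; exact norm_add_le _ _) ?_ ?_).trans (add_le_add hD1 hS1)
    · rw [e1]; exact B9SupplySockB9P3ZdLettersOmega.bdd_neg_of_pointwise hL hη 1 fun b => hAGglob b.1 b.2
    · rw [e1]; exact B9SupplySockB9P3ZdLettersOmega.bdd_neg_of_pointwise hL hη 1 fun b => hGSglob b.1 b.2
  have hL2 : msup L m i.η (-(2 : ℝ)) (fun j (t : Fin d × Fin d × Site d) => SideTouches (i.Ω j) t.2.2 t.2.1)
      (fun t => covDerivFwd i.η U₀ t.1 (fun z => A' z t.2.1) t.2.2) ≤ B₀ * N + cS * F := by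
    refine (msup_le_add_of_norm_le hη.le
      (F := fun t : Fin d × Fin d × Site d => covDerivFwd i.η U₀ t.1 (fun z => (A' - GS) z t.2.1) t.2.2)
      (G := fun t : Fin d × Fin d × Site d => covDerivFwd i.η U₀ t.1 (fun z => GS z t.2.1) t.2.2)
      (fun t => ?_) ?_ ?_).trans (add_le_add hD2 hS2)
    · have h : (fun z => A' z t.2.1) = (fun z => (A' - GS) z t.2.1) + fun z => GS z t.2.1 := by
        funext z; simp
      rw [h, B8LambdaSpaceKLevel.covDerivFwd_add']
      exact norm_add_le _ _
    · rw [e2]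
      refine B9SupplySockB9P3ZdLettersOmega.bdd_neg_of_pointwise hL hη 2 (c := i.η⁻¹ * ((α₂ * i.η⁻¹ + C) + (α₂ * i.η⁻¹ + C))) fun t => ?_
      exact (B9SupplySockB9P3ZdLettersOmega.norm_covDerivFwd_le hη (hU₀1 _ _) _).trans
        (mul_le_mul_of_nonneg_left (add_le_add (hAGglob _ _) (hAGglob _ _)) (inv_nonneg.mpr hη.le))
    · rw [e2]
      refine B9SupplySockB9P3ZdLettersOmega.bdd_neg_of_pointwise hL hη 2 (c := i.η⁻¹ * (C + C)) fun t => ?_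
      exact (B9SupplySockB9P3ZdLettersOmega.norm_covDerivFwd_le hη (hU₀1 _ _) _).trans
        (mul_le_mul_of_nonneg_left (add_le_add (hGSglob _ _) (hGSglob _ _)) (inv_nonneg.mpr hη.le))
  have hL4 : bondNorm L m i.η (-(3 : ℝ)) i.Ω (fun x μ => covLap i.η U₀ (fun z => A' z μ) x) ≤ B₀ * N + cS * F := by
    unfold bondNorm at hD4 hS4 ⊢
    refine (msup_le_add_of_norm_le hη.le
      (F := fun b : Site d × Fin d => covLap i.η U₀ (fun z => (A' - GS) z b.2) b.1)
      (G := fun b : Site d × Fin d => covLap i.η U₀ (fun z => GS z b.2) b.1)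
      (fun b => ?_) ?_ ?_).trans (add_le_add hD4 hS4)
    · dsimp only
      have h : (fun z => A' z b.2) = (fun z => (A' - GS) z b.2) + fun z => GS z b.2 := by
        funext z; simp
      rw [h, B9SupplySockB9P3ZdLettersOmega.covLap_add]
      exact norm_add_le _ _
    · rw [e3]
      exact B9SupplySockB9P3ZdLettersOmega.bdd_neg_of_pointwise hL hη 3 fun b =>
        B9SupplySockB9P3ZdLettersOmega.norm_covLap_le hη hU₀1 (fun y => hAGglob y b.2) b.1
    · rw [e3]
      exact B9SupplySockB9P3ZdLettersOmega.bdd_neg_of_pointwise hL hη 3 fun b =>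
        B9SupplySockB9P3ZdLettersOmega.norm_covLap_le hη hU₀1 (fun y => hGSglob y b.2) b.1
  have hCβ0 : 0 ≤ max 0 (CH * Bβ β) := le_max_left _ _
  have hN0 : 0 ≤ N := by rw [hN_def]; exact B8ScaledSupNorm.msup_nonneg L m hη.le _ _ _
  have hL5 : msup L m i.η (-(2 + β))
      (fun j (q : Fin d × Fin d × (Site d × Site d)) => q.2.2 ∈ AdmPair i.η len ∧ q.2.2.1 ∈ i.Ω j)
      (fun q => hquot i.η β len U₀ (covDerivFwd i.η U₀ q.1 (fun z => A' z q.2.1)) q.2.2) ≤ max 0 (CH * Bβ β) * N + cSβ * F := by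
    by_cases hB : Bdd L m i.η (-(2 + β))
        (fun j (q : Fin d × Fin d × (Site d × Site d)) => q.2.2 ∈ AdmPair i.η len ∧ q.2.2.1 ∈ i.Ω j)
        (fun q => hquot i.η β len U₀ (covDerivFwd i.η U₀ q.1 (fun z => A' z q.2.1)) q.2.2)
    · -- bounded: the family of A′ − GS is bounded too, and the norm splits
      have hcd : ∀ q : Fin d × Fin d × (Site d × Site d),
          covDerivFwd i.η U₀ q.1 (fun z => (A' - GS) z q.2.1) =
            covDerivFwd i.η U₀ q.1 (fun z => A' z q.2.1) - covDerivFwd i.η U₀ q.1 (fun z => GS z q.2.1) := by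
        intro q
        funext x
        have h : (fun z => A' z q.2.1) = (fun z => (A' - GS) z q.2.1) + fun z => GS z q.2.1 := by
          funext z; simp
        rw [Pi.sub_apply, h, B8LambdaSpaceKLevel.covDerivFwd_add']
        abel
      have hcd' : ∀ q : Fin d × Fin d × (Site d × Site d),
          covDerivFwd i.η U₀ q.1 (fun z => A' z q.2.1) =
            covDerivFwd i.η U₀ q.1 (fun z => (A' - GS) z q.2.1) + covDerivFwd i.η U₀ q.1 (fun z => GS z q.2.1) := by
        intro q; rw [hcd]; abel
      have hBdiff : Bdd L m i.η (-(2 + β))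
          (fun j (q : Fin d × Fin d × (Site d × Site d)) => q.2.2 ∈ AdmPair i.η len ∧ q.2.2.1 ∈ i.Ω j)
          (fun q => hquot i.η β len U₀ (covDerivFwd i.η U₀ q.1 (fun z => (A' - GS) z q.2.1)) q.2.2) := by
        obtain ⟨c₁, hc₁⟩ := hB
        obtain ⟨c₂, hc₂⟩ := hSbdd
        refine ⟨c₁ + c₂, fun j hj q hq => ?_⟩
        have hw0 : 0 ≤ weight L i.η (-(2 + β)) j := B8ScaledSupNorm.weight_nonneg L hη.le _ j
        have hle : hquot i.η β len U₀ (covDerivFwd i.η U₀ q.1 (fun z => (A' - GS) z q.2.1)) q.2.2 ≤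
            hquot i.η β len U₀ (covDerivFwd i.η U₀ q.1 (fun z => A' z q.2.1)) q.2.2 +
              hquot i.η β len U₀ (covDerivFwd i.η U₀ q.1 (fun z => GS z q.2.1)) q.2.2 := by
          rw [hcd]; exact hquot_sub_le hη.le β U₀ _ _ hq.1
        have hn : ∀ r : ℝ, 0 ≤ r → ‖r‖ = r := fun r hr => Real.norm_of_nonneg hr
        have hq1 := B9Eq340HolderZd.hquot_nonneg hη.le β U₀ (covDerivFwd i.η U₀ q.1 (fun z => (A' - GS) z q.2.1)) hq.1
        have hq2 := B9Eq340HolderZd.hquot_nonneg hη.le β U₀ (covDerivFwd i.η U₀ q.1 (fun z => A' z q.2.1)) hq.1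
        have hq3 := B9Eq340HolderZd.hquot_nonneg hη.le β U₀ (covDerivFwd i.η U₀ q.1 (fun z => GS z q.2.1)) hq.1
        have h₁ := hc₁ j hj q hq
        have h₂ := hc₂ j hj q hq
        rw [hn _ hq2] at h₁
        rw [hn _ hq3] at h₂
        rw [hn _ hq1]
        calc weight L i.η (-(2 + β)) j * hquot i.η β len U₀ (covDerivFwd i.η U₀ q.1 (fun z => (A' - GS) z q.2.1)) q.2.2
            ≤ weight L i.η (-(2 + β)) j * (hquot i.η β len U₀ (covDerivFwd i.η U₀ q.1 (fun z => A' z q.2.1)) q.2.2 +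
              hquot i.η β len U₀ (covDerivFwd i.η U₀ q.1 (fun z => GS z q.2.1)) q.2.2) := mul_le_mul_of_nonneg_left hle hw0
          _ ≤ c₁ + c₂ := by rw [mul_add]; exact add_le_add h₁ h₂
      refine (msup_le_add_of_norm_le hη.le
        (F := fun q : Fin d × Fin d × (Site d × Site d) => hquot i.η β len U₀ (covDerivFwd i.η U₀ q.1 (fun z => (A' - GS) z q.2.1)) q.2.2)
        (G := fun q : Fin d × Fin d × (Site d × Site d) => hquot i.η β len U₀ (covDerivFwd i.η U₀ q.1 (fun z => GS z q.2.1)) q.2.2)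
        (fun q => ?_) hBdiff hSbdd).trans (add_le_add hD5 hS5)
      -- pointwise: on non-admissible pairs both sides may be junk, but the norm splitting only needs `‖x‖ ≤ ‖y‖ + ‖z‖`
      by_cases hq : q.2.2 ∈ AdmPair i.η len
      · have hq1 := B9Eq340HolderZd.hquot_nonneg hη.le β U₀ (covDerivFwd i.η U₀ q.1 (fun z => (A' - GS) z q.2.1)) hq
        have hq2 := B9Eq340HolderZd.hquot_nonneg hη.le β U₀ (covDerivFwd i.η U₀ q.1 (fun z => A' z q.2.1)) hq
        have hq3 := B9Eq340HolderZd.hquot_nonneg hη.le β U₀ (covDerivFwd i.η U₀ q.1 (fun z => GS z q.2.1)) hq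
        rw [Real.norm_of_nonneg hq1, Real.norm_of_nonneg hq2, Real.norm_of_nonneg hq3, hcd']
        exact hquot_add_le hη.le β U₀ _ _ hq
      · -- off the admissible pairs the quotient's denominator is the same on both sides: split the numerator
        simp only [B9Eq340HolderZd.hquot_def, hcd', Real.norm_eq_abs, abs_div]
        rw [← add_div]
        by_cases hden : |(i.η * len (q.2.2.2 - q.2.2.1)) ^ β| = 0
        · simp [hden]
        · refine div_le_div_of_nonneg_right ?_ (lt_of_le_of_ne (abs_nonneg _) (Ne.symm hden)).le
          rw [abs_of_nonneg (norm_nonneg _), abs_of_nonneg (norm_nonneg _), abs_of_nonneg (norm_nonneg _), Pi.add_apply, trans_add]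
          calc ‖trans U₀ q.2.2.1 q.2.2.2 (covDerivFwd i.η U₀ q.1 (fun z => (A' - GS) z q.2.1) q.2.2.2) +
                  trans U₀ q.2.2.1 q.2.2.2 (covDerivFwd i.η U₀ q.1 (fun z => GS z q.2.1) q.2.2.2) -
                (covDerivFwd i.η U₀ q.1 (fun z => (A' - GS) z q.2.1) q.2.2.1 + covDerivFwd i.η U₀ q.1 (fun z => GS z q.2.1) q.2.2.1)‖
              = ‖(trans U₀ q.2.2.1 q.2.2.2 (covDerivFwd i.η U₀ q.1 (fun z => (A' - GS) z q.2.1) q.2.2.2) -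
                    covDerivFwd i.η U₀ q.1 (fun z => (A' - GS) z q.2.1) q.2.2.1) +
                  (trans U₀ q.2.2.1 q.2.2.2 (covDerivFwd i.η U₀ q.1 (fun z => GS z q.2.1) q.2.2.2) -
                    covDerivFwd i.η U₀ q.1 (fun z => GS z q.2.1) q.2.2.1)‖ := by congr 1; abel
            _ ≤ _ := norm_add_le _ _
    · rw [msup_eq_zero_of_not_bdd hB]
      positivity
  -- the a-priori (Neumann) step with the additive source
  have hJJ : bondNorm L m i.η (-(3 : ℝ)) i.Ω (fun x μ => pdiv i.η U₀ (plaqCovDeriv i.η U₀ A') μ x) = nJ := by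
    rw [hnJ_def]; rfl
  have hSa : 0 ≤ cS * F := mul_nonneg hcS hF0
  obtain ⟨r1, r2, r3, r4, r5⟩ := apriori_arith_src (Sh := cSβ * F) hB₀ hq hκ' hθ ha0 hnJ0 hnB0 hCβ0 hSa hJt hL1 hL2 hL4 hL5
  rw [← ha_def, ← hnJ_def, ← hnB_def, hJJ, ← hF_def]
  exact ⟨r1, r2, r3, r4, r5⟩

/-! ## §4 The sourced sockets of the N05 record knit at the `Ω₀ = ℤᵈ` members, from `B9.Thm33Printed` BY NAME -/

omit [Nontrivial 𝔸] in
/-- On every bond, `(iη)⁻¹ log W = A′` for a datum with `W = e^{iηA′}`, `‖A′‖ ≤ α₂(Lʲη)⁻¹` on the sides of the plaquettes touching `Ω_j` and `Ω₀ = ℤᵈ`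
(`d ≥ 2`: every bond is such a side at level `0`), `16α₂ ≤ 1` (`B8Prop3GaugeFixedKLevel.logField_spec`). [cite: Balaban1985RegularSpaces, (1.36) p.82, (1.41) p.83] -/
theorem logCfg_eq_of_univ (hd2 : 2 ≤ d) {m : ℕ} {η : ℝ} (hη : 0 < η) {Ω : ℕ → Set (Site d)} (hΩ : Ω 0 = Set.univ)
    (U₀ : Site d → Fin d → 𝔸ˣ) {W : Site d → Fin d → 𝔸ˣ} (hWu : ∀ x κ, W x κ ∈ unitaryUnits 𝔸) {A' : Site d → Fin d → 𝔸} {α₂ : ℝ}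
    (h16 : α₂ ≤ 1 / 16)
    (h41 : ∀ j, j ≤ m → ∀ (y : Site d) (τ : Fin d), SideTouches (Ω j) y τ →
      W y τ = cfgExp η A' y τ ∧ ‖A' y τ‖ ≤ α₂ * ((L : ℝ) ^ j * η)⁻¹) (x : Site d) (μ : Fin d) :
    logCfg η W x μ = A' x μ := by
  haveI : Nontrivial (Fin d) := Fin.nontrivial_iff_two_le.mpr hd2
  obtain ⟨κ, hκ⟩ := exists_ne μ
  have hb : BondTouches (Ω 0) x μ := Or.inl (by rw [hΩ]; exact Set.mem_univ x)
  have hs : SideTouches (Ω 0) x μ := B8Eq140Level.sideTouches_of_bondTouches hκ hb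
  obtain ⟨hW, hA⟩ := h41 0 (Nat.zero_le _) x μ hs
  have hA' : ‖A' x μ‖ ≤ α₂ * η⁻¹ := by simpa using hA
  exact (B8Prop3GaugeFixedKLevel.logField_spec hη U₀ hWu hW hA' h16).1

/-- ★★ **THE `SB9srcH` BINDER OF THE N05 RECORD KNIT (dag-n05-d `…N05SubBHKnitUnivT8Srv`, Proposition 3's frame at the gauge condition (1.146)) AT THE
`Ω₀ = ℤᵈ` MEMBERS, FROM [4] THEOREM 3.3 BY NAME**: `B9.Thm33Printed c35 geo bg Gp GA` + `DictGlob` + `Prop6Feed` + the E(Ω₀)-binders `InvOnDom`∕`CurvSmallDom`∕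
`AvgBoundDom`∕`HolderGlob` + the source binders `GopAdd`∕`SourceTermDom`∕`SourceHolderDom` give, over any `ι : J → ZdIdx d L` with `(ι j).Ω 0 = Set.univ` and for the
consumer's `γ₈ ≥ 0`, constants `B₀′ > 0`, `B₀β ≥ 0`, `cP > 0`, `γ″ ≥ 0`, `γβ ≥ 0` such that the `SB9srcH` BODY holds VERBATIM at every `ι j` (all five (1.59) lines at the top
level with `+ γ″B₀′(α₀ + α₁)`, Hölder `+ γβ(α₀ + α₁)`).  Used: `U₀ ∈ 𝔄`, `W = e^{iηA′}` + (1.41) + support, `IsLandau146W`'s multiplier clause, `Bdd` + `|f|₍₋₂₎ <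
γ₈(α₀ + α₁)`; unused (print p. 101: only `|f|₍₋₂₎` matters): `f ∈ R(U₀)`, `f` Hermitian ∕ supported, `|∇f|₍₋₃₎`, `WU₀ ∈ 𝔄`, «A′ Hermitian».
[cite: Balaban1985RegularSpaces, Thm 8 + (1.146) p.101, Prop. 3 p.87, (1.59) p.86; Balaban1985BackgroundPropagators, Thm 3.3 p.399] -/
theorem sockB9P3srcH_of_thm33_univ (hd2 : 2 ≤ d) (hL : 1 ≤ L) {c35 c₆ K₆ M₃ a₃ c69 q CH β cS cSβ : ℝ} {len : Site d → ℝ}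
    {Gp : ∀ i, B9.KernelFamily (geo i) (bg i)} (h33 : B9.Thm33Printed c35 geo bg Gp GA)
    (hdict : DictGlob geo bg GA L mem ιCfg ιLoc ops) (hP6 : Prop6Feed bg L mem ιCfg c35 M₃ c₆ K₆)
    (hinv : InvOnDom bg L mem ιCfg ops c35 M₃ a₃) (hcurv : CurvSmallDom bg L mem ιCfg ops c35 M₃ a₃ c69) (havg : AvgBoundDom L ops q)
    (hhol : HolderGlob geo bg GA L mem ιCfg ops β len CH) (hadd : GopAdd L ops)
    (hsrc : SourceTermDom bg L mem ιCfg ops c35 M₃ a₃ cS) (hsrcH : SourceHolderDom bg L mem ιCfg ops c35 M₃ a₃ β len cSβ)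
    (hc₆ : 0 < c₆) (hK₆ : 0 < K₆) (ha₃ : 0 < a₃) (hc69 : 0 ≤ c69) (hq : 0 ≤ q) (hcS : 0 ≤ cS) (hcSβ : 0 ≤ cSβ)
    {J : Type*} (ι : J → ZdIdx d L) (hΩJ : ∀ j, (ι j).Ω 0 = Set.univ) {γ₈ : ℝ} (hγ₈ : 0 ≤ γ₈) :
    ∃ B₀' B₀β cP γ'' γβ : ℝ, 0 < B₀' ∧ 0 ≤ B₀β ∧ 0 < cP ∧ 0 ≤ γ'' ∧ 0 ≤ γβ ∧ ∀ jj : J,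
      ∀ α₀ α₁ α₂ : ℝ, 0 < α₀ → α₀ ≤ cP → 0 < α₁ → 0 < α₂ → α₂ ≤ cP →
      ∀ (U₀ W : Site d → Fin d → 𝔸ˣ), (∀ x κ, U₀ x κ ∈ unitaryUnits 𝔸) → (∀ x κ, W x κ ∈ unitaryUnits 𝔸) →
      ∀ f : Site d → 𝔸, InR138 L (ι jj).k (ι jj).η ((ι jj).Ω 0) ((ι jj).Λs (ι jj).k) U₀ f →
      (∀ x, IsSelfAdjoint (f x)) → (∀ x, x ∉ (ι jj).Ω 0 → f x = 0) →
      Bdd L (ι jj).k (ι jj).η (-(2 : ℝ)) (fun j (x : Site d) => x ∈ (ι jj).Ω j) f →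
      msup L (ι jj).k (ι jj).η (-(2 : ℝ)) (fun j (x : Site d) => x ∈ (ι jj).Ω j) f < γ₈ * (α₀ + α₁) →
      msup L (ι jj).k (ι jj).η (-(3 : ℝ)) (fun j (p : Fin d × Site d) => p.2 ∈ (ι jj).Ω j) (fun p => covDerivFwd (ι jj).η U₀ p.1 f p.2) < γ₈ * (α₀ + α₁) →
      InAk L (ι jj).k (ι jj).η α₀ (ι jj).Ω U₀ → InAk L (ι jj).k (ι jj).η α₀ (ι jj).Ω (mulCfg W U₀) →
      IsLandau146W L (ι jj).k (ι jj).η ((ι jj).Ω 0) ((ι jj).Λs (ι jj).k) U₀ f W →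
      ∀ A' : Site d → Fin d → 𝔸, (∀ y τ, IsSelfAdjoint (A' y τ)) →
      (∀ j, j ≤ (ι jj).k → ∀ (y : Site d) (τ : Fin d), SideTouches ((ι jj).Ω j) y τ →
        W y τ = cfgExp (ι jj).η A' y τ ∧ ‖A' y τ‖ ≤ α₂ * ((L : ℝ) ^ j * (ι jj).η)⁻¹) →
      (∀ (y : Site d) (τ : Fin d), (∀ j, j ≤ (ι jj).k → ¬ SideTouches ((ι jj).Ω j) y τ) → A' y τ = 0) →
      msup L (ι jj).k (ι jj).η (-(1 : ℝ)) (fun j (b : Site d × Fin d) => SideTouches ((ι jj).Ω j) b.1 b.2) (fun b => A' b.1 b.2)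
          ≤ B₀' * (bondNorm L (ι jj).k (ι jj).η (-(3 : ℝ)) (ι jj).Ω (fun x μ => Jcur (ι jj).η U₀ A' μ x)
            + wsup 1 (fun p : {p : ℕ × (Site d × Fin d) // p.1 ≤ (ι jj).k ∧ p.2 ∈ (ι jj).Λb (ι jj).k p.1} =>
                linCovIter L U₀ (iEta (ι jj).η A') p.1.1 p.1.2.1 p.1.2.2)) + γ'' * B₀' * (α₀ + α₁) ∧
        msup L (ι jj).k (ι jj).η (-(2 : ℝ)) (fun j (t : Fin d × Fin d × Site d) => SideTouches ((ι jj).Ω j) t.2.2 t.2.1)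
            (fun t => covDerivFwd (ι jj).η U₀ t.1 (fun z => A' z t.2.1) t.2.2)
          ≤ B₀' * (bondNorm L (ι jj).k (ι jj).η (-(3 : ℝ)) (ι jj).Ω (fun x μ => Jcur (ι jj).η U₀ A' μ x)
            + wsup 1 (fun p : {p : ℕ × (Site d × Fin d) // p.1 ≤ (ι jj).k ∧ p.2 ∈ (ι jj).Λb (ι jj).k p.1} =>
                linCovIter L U₀ (iEta (ι jj).η A') p.1.1 p.1.2.1 p.1.2.2)) + γ'' * B₀' * (α₀ + α₁) ∧
        bondNorm L (ι jj).k (ι jj).η (-(3 : ℝ)) (ι jj).Ω (fun x μ => pdiv (ι jj).η U₀ (plaqCovDeriv (ι jj).η U₀ A') μ x)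
          ≤ B₀' * (bondNorm L (ι jj).k (ι jj).η (-(3 : ℝ)) (ι jj).Ω (fun x μ => Jcur (ι jj).η U₀ A' μ x)
            + wsup 1 (fun p : {p : ℕ × (Site d × Fin d) // p.1 ≤ (ι jj).k ∧ p.2 ∈ (ι jj).Λb (ι jj).k p.1} =>
                linCovIter L U₀ (iEta (ι jj).η A') p.1.1 p.1.2.1 p.1.2.2)) + γ'' * B₀' * (α₀ + α₁) ∧
        bondNorm L (ι jj).k (ι jj).η (-(3 : ℝ)) (ι jj).Ω (fun x μ => covLap (ι jj).η U₀ (fun z => A' z μ) x)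
          ≤ B₀' * (bondNorm L (ι jj).k (ι jj).η (-(3 : ℝ)) (ι jj).Ω (fun x μ => Jcur (ι jj).η U₀ A' μ x)
            + wsup 1 (fun p : {p : ℕ × (Site d × Fin d) // p.1 ≤ (ι jj).k ∧ p.2 ∈ (ι jj).Λb (ι jj).k p.1} =>
                linCovIter L U₀ (iEta (ι jj).η A') p.1.1 p.1.2.1 p.1.2.2)) + γ'' * B₀' * (α₀ + α₁) ∧
        msup L (ι jj).k (ι jj).η (-(2 + β)) (fun j (q : Fin d × Fin d × (Site d × Site d)) => q.2.2 ∈ AdmPair (ι jj).η len ∧ q.2.2.1 ∈ (ι jj).Ω j)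
            (fun q => hquot (ι jj).η β len U₀ (covDerivFwd (ι jj).η U₀ q.1 (fun z => A' z q.2.1)) q.2.2)
          ≤ B₀β * (bondNorm L (ι jj).k (ι jj).η (-(3 : ℝ)) (ι jj).Ω (fun x μ => Jcur (ι jj).η U₀ A' μ x)
            + wsup 1 (fun p : {p : ℕ × (Site d × Fin d) // p.1 ≤ (ι jj).k ∧ p.2 ∈ (ι jj).Λb (ι jj).k p.1} =>
                linCovIter L U₀ (iEta (ι jj).η A') p.1.1 p.1.2.1 p.1.2.2)) + γβ * (α₀ + α₁) := by
  obtain ⟨M₁, δ₀, a₀, B₀, Bβ, Bε, Bεβ, -, -, ha₀, hB₀, H⟩ := h33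
  obtain ⟨M, hM_def⟩ : ∃ M : ℝ, M = max 1 (max M₁ M₃) := ⟨_, rfl⟩
  have hM1 : 1 ≤ M := by rw [hM_def]; exact le_max_left _ _
  have hMM₁ : M₁ ≤ M := by rw [hM_def]; exact (le_max_left _ _).trans (le_max_right _ _)
  have hMM₃ : M₃ ≤ M := by rw [hM_def]; exact (le_max_right _ _).trans (le_max_right _ _)
  have hM0 : 0 < M := lt_of_lt_of_le one_pos hM1
  have hKM : 0 < K₆ * M := mul_pos hK₆ hM0
  obtain ⟨B', hB'_def⟩ : ∃ B' : ℝ, B' = max 1 (2 * B₀ * max 1 q) := ⟨_, rfl⟩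
  have hB'1 : 1 ≤ B' := by rw [hB'_def]; exact le_max_left _ _
  have hB'0 : 0 < B' := lt_of_lt_of_le one_pos hB'1
  have hCβ0 : 0 ≤ max 0 (CH * Bβ β) := le_max_left _ _
  refine ⟨B', 2 * max 0 (CH * Bβ β) * max 1 q,
    min (1 / 16) (min (c₆ / M) (min (a₀ / (K₆ * M)) (min (a₃ / (K₆ * M)) (1 / (2 * B₀ * c69 * K₆ * M + 1))))),
    2 * cS * γ₈ / B', (max 0 (CH * Bβ β) * cS / B₀ + cSβ) * γ₈, hB'0, by positivity, ?_, by positivity, by positivity, fun jj => ?_⟩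
  · refine lt_min (by norm_num) (lt_min (div_pos hc₆ hM0) (lt_min (div_pos ha₀ hKM) (lt_min (div_pos ha₃ hKM) ?_)))
    have : 0 < 2 * B₀ * c69 * K₆ * M + 1 := by positivity
    positivity
  intro α₀ α₁ α₂ hα₀ hα₀c hα₁ hα₂ hα₂c U₀ W hU₀ hWu f _ _ _ hfB hfF _ hInA _ hLW A' _ h41 hA0
  have hη : 0 < (ι jj).η := (ι jj).hη
  have hα₂16 : α₂ ≤ 1 / 16 := hα₂c.trans (min_le_left _ _)
  -- the multiplier clause for A′ = (iη)⁻¹ log W on every bond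
  have hlog : ∀ (x : Site d) (μ : Fin d), BondTouches ((ι jj).Ω 0) x μ → logCfg (ι jj).η W x μ = A' x μ :=
    fun x μ _ => logCfg_eq_of_univ L hd2 hη (hΩJ jj) U₀ hWu hα₂16 h41 x μ
  have hcl : ∃ μ : ℕ → Site d → 𝔸, ∀ x ∈ (ι jj).Ω 0,
      covLap (ι jj).η U₀ (((ι jj).Ω 0).indicator (covDivB (ι jj).η U₀ A' - f)) x = QT L (ι jj).k ((ι jj).Λs (ι jj).k) U₀ μ x :=
    (mulClause_congr f hlog).1 hLW.2
  have h33U : ∀ (α : ℝ) (V : Site d → Fin d → 𝔸ˣ) (hV : ∀ x κ, V x κ ∈ unitaryUnits 𝔸), 0 < α → M * α ≤ a₀ →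
      (bg (mem M (ι jj) (ι jj).k)).Reg335 c35 α (ιCfg M (ι jj) (ι jj).k V hV) →
      B9.Ineq342_346_347 (GA (mem M (ι jj) (ι jj).k)) B₀ δ₀ (ιCfg M (ι jj) (ι jj).k V hV) ∧
        B9.Ineq343_345 (GA (mem M (ι jj) (ι jj).k)) Bβ Bε Bεβ δ₀ (ιCfg M (ι jj) (ι jj).k V hV) := by
    intro α V hV hα hMa hreg
    have hMi : M₁ ≤ (geo (mem M (ι jj) (ι jj).k)).M := by rw [(hdict M (ι jj) (ι jj).k).1]; exact hMM₁
    have hMa' : (geo (mem M (ι jj) (ι jj).k)).M * α ≤ a₀ := by rw [(hdict M (ι jj) (ι jj).k).1]; exact hMa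
    exact (H (mem M (ι jj) (ι jj).k) hMi α hα hMa' (ιCfg M (ι jj) (ι jj).k V hV) hreg).2
  obtain ⟨r1, r2, r3, r4, r5⟩ := sockSrc_core_at_univ geo bg GA L mem ιCfg ιLoc ops hL hdict hP6 hinv hcurv havg hhol hadd hsrc hsrcH
    hK₆ hc69 hq hcS hcSβ hM1 hMM₃ (ι jj) (hΩJ jj) (ι jj).k hB₀ h33U α₀ α₂ hα₀ hα₀c hα₂ hα₂16 U₀ hU₀ hInA A'
    (fun j hj y τ hs => (h41 j hj y τ hs).2) hA0 f hfB hcl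
  rw [← hB'_def] at r1 r2 r3 r4
  -- the source allowance: 2c_S|f|₍₋₂₎ ≤ γ″B₀′(α₀ + α₁), (C_βc_S∕B₀ + c_Sβ)|f|₍₋₂₎ ≤ γβ(α₀ + α₁)
  obtain ⟨F, hF_def⟩ : ∃ F : ℝ, F = msup L (ι jj).k (ι jj).η (-(2 : ℝ)) (fun j (x : Site d) => x ∈ (ι jj).Ω j) f := ⟨_, rfl⟩
  rw [← hF_def] at r1 r2 r4 r5 hfF
  have hF0 : 0 ≤ F := by rw [hF_def]; exact B8ScaledSupNorm.msup_nonneg L _ hη.le _ _ _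
  have hS : 2 * (cS * F) ≤ 2 * cS * γ₈ / B' * B' * (α₀ + α₁) := by
    have h1 : cS * F ≤ cS * (γ₈ * (α₀ + α₁)) := mul_le_mul_of_nonneg_left hfF.le hcS
    have h2 : 2 * cS * γ₈ / B' * B' * (α₀ + α₁) = 2 * (cS * (γ₈ * (α₀ + α₁))) := by field_simp
    linarith
  have hSβ : max 0 (CH * Bβ β) * (cS * F) / B₀ + cSβ * F ≤ (max 0 (CH * Bβ β) * cS / B₀ + cSβ) * γ₈ * (α₀ + α₁) := by
    have h1 : cS * F ≤ cS * (γ₈ * (α₀ + α₁)) := mul_le_mul_of_nonneg_left hfF.le hcS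
    have h2 : max 0 (CH * Bβ β) * (cS * F) / B₀ ≤ max 0 (CH * Bβ β) * (cS * (γ₈ * (α₀ + α₁))) / B₀ :=
      div_le_div_of_nonneg_right (mul_le_mul_of_nonneg_left h1 hCβ0) hB₀.le
    have h3 : cSβ * F ≤ cSβ * (γ₈ * (α₀ + α₁)) := mul_le_mul_of_nonneg_left hfF.le hcSβ
    have h4 : (max 0 (CH * Bβ β) * cS / B₀ + cSβ) * γ₈ * (α₀ + α₁) =
        max 0 (CH * Bβ β) * (cS * (γ₈ * (α₀ + α₁))) / B₀ + cSβ * (γ₈ * (α₀ + α₁)) := by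
      field_simp
    linarith
  have hnn : 0 ≤ 2 * cS * γ₈ / B' * B' * (α₀ + α₁) := by
    have : 0 ≤ α₀ + α₁ := by linarith
    positivity
  exact ⟨r1.trans (by linarith), r2.trans (by linarith), r3.trans (le_add_of_nonneg_right hnn), r4.trans (by linarith), r5.trans (by linarith)⟩

/-- ★★ **THE `SH59src` BINDER OF THE N05 RECORD KNIT (dag-n05-d `…N05SubBHKnitUnivT8Srv`, Theorem 4's frame with source: the two (1.59) lines at every
truncation level `m`, gauge condition `B8LanF146.LanF146`) AT THE `Ω₀ = ℤᵈ` MEMBERS, FROM [4] THEOREM 3.3 BY NAME** — the sourced analogue of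
`B9SupplySockB9P3ZdOmega.sockH59D_of_allLevelsD4` ∘ `sockSrc_core_at_univ`: for any smallness constants `B₈ > 0`, `B₀″ ≥ 0` (the consumer's `B₈`,
`λ.inp.B₀′`) and the consumer's `γ₈ ≥ 0`, constants `B₀′ > 0`, `c59 = min cP (cP∕K₀) > 0` (`K₀ = 2L·5dLB₈ + 8·8B₀″·5dLB₈`), `γ′ = 2c_Sγ₈∕B₀′ ≥ 0` with the
`SH59src` BODY VERBATIM at every `ι j`.  The datum `W = U′^{u⁻¹}` is unitary-valued, `U₀ ∈ 𝔄_m` by restriction of levels, and `LanF146`'s multiplier clause at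
level `m` is the one the source binder reads (no membership `φ ∈ R_m` is used, as none is available below the top — dag-n05-c's located point).
[cite: Balaban1985RegularSpaces, Thm 8 + (1.146) p.101, Thm 4 p.88, (1.59) p.86, (1.69) p.88; Balaban1985BackgroundPropagators, Thm 3.3 p.399] -/
theorem sockH59src_of_thm33_univ (hd2 : 2 ≤ d) (hL : 1 ≤ L) {c35 c₆ K₆ M₃ a₃ c69 q CH β cS cSβ : ℝ} {len : Site d → ℝ}
    {Gp : ∀ i, B9.KernelFamily (geo i) (bg i)} (h33 : B9.Thm33Printed c35 geo bg Gp GA)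
    (hdict : DictGlob geo bg GA L mem ιCfg ιLoc ops) (hP6 : Prop6Feed bg L mem ιCfg c35 M₃ c₆ K₆)
    (hinv : InvOnDom bg L mem ιCfg ops c35 M₃ a₃) (hcurv : CurvSmallDom bg L mem ιCfg ops c35 M₃ a₃ c69) (havg : AvgBoundDom L ops q)
    (hhol : HolderGlob geo bg GA L mem ιCfg ops β len CH) (hadd : GopAdd L ops)
    (hsrc : SourceTermDom bg L mem ιCfg ops c35 M₃ a₃ cS) (hsrcH : SourceHolderDom bg L mem ιCfg ops c35 M₃ a₃ β len cSβ)
    (hc₆ : 0 < c₆) (hK₆ : 0 < K₆) (ha₃ : 0 < a₃) (hc69 : 0 ≤ c69) (hq : 0 ≤ q) (hcS : 0 ≤ cS) (hcSβ : 0 ≤ cSβ)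
    {J : Type*} (ι : J → ZdIdx d L) (hΩJ : ∀ j, (ι j).Ω 0 = Set.univ) {γ₈ B₈ B₀'' : ℝ} (hγ₈ : 0 ≤ γ₈) (hB₈ : 0 < B₈) (hB₀'' : 0 ≤ B₀'') :
    ∃ B₀' c59 γ' : ℝ, 0 < B₀' ∧ 0 < c59 ∧ 0 ≤ γ' ∧ ∀ jj : J,
      ∀ α₀ α₁ : ℝ, 0 < α₀ → 0 < α₁ → α₀ + α₁ ≤ c59 →
      ∀ U₀ U' : Site d → Fin d → 𝔸ˣ, (∀ x κ, U₀ x κ ∈ unitaryUnits 𝔸) → (∀ x κ, U' x κ ∈ unitaryUnits 𝔸) →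
      ∀ φ : Site d → 𝔸, ((InR138 L (ι jj).k (ι jj).η ((ι jj).Ω 0) ((ι jj).Λs (ι jj).k) U₀ φ ∧ (∀ x, IsSelfAdjoint (φ x)) ∧
          (∀ x, x ∉ (ι jj).Ω 0 → φ x = 0) ∧ Bdd L (ι jj).k (ι jj).η (-(2 : ℝ)) (fun j (x : Site d) => x ∈ (ι jj).Ω j) φ) ∧
        msup L (ι jj).k (ι jj).η (-(2 : ℝ)) (fun j (x : Site d) => x ∈ (ι jj).Ω j) φ < γ₈ * (α₀ + α₁)) →
      InAk L (ι jj).k (ι jj).η α₀ (ι jj).Ω U₀ → InAk L (ι jj).k (ι jj).η α₀ (ι jj).Ω (mulCfg U' U₀) →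
      (∀ m, m ≤ (ι jj).k → InAx L m ((ι jj).Λs m) U₀ (mulCfg U' U₀)) →
      (∀ j, j ≤ (ι jj).k → ∀ (z : Site d) (μ : Fin d), (∀ x, InBox (loK L j z) (bondHiK L j z μ) x → x ∈ (ι jj).Ω j) →
        ‖(avgIter L (mulCfg U' U₀) j z μ : 𝔸) - (avgIter L U₀ j z μ : 𝔸)‖ ≤ α₁) →
      (∀ b ∈ {b : Site d × Fin d | SideTouches ((ι jj).Ω 0) b.1 b.2}, ‖((U' b.1 b.2 : 𝔸ˣ) : 𝔸) - 1‖ ≤ α₁) →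
      (∀ m, 1 ≤ m → m ≤ (ι jj).k → ∀ (u : Site d → 𝔸ˣ) (W : Site d → Fin d → 𝔸ˣ) (A' : Site d → Fin d → 𝔸),
        (∀ x, u x ∈ unitaryUnits 𝔸) → mgauge U₀ u W = U' → Restr129 L m ((ι jj).Λs m) U₀ u →
        LanF146 L (ι jj).k (ι jj).η ((ι jj).Ω 0) (ι jj).Λs U₀ φ m W →
        (∀ y τ, IsSelfAdjoint (A' y τ)) →
        (∀ j, j ≤ m → ∀ y τ, SideTouches ((ι jj).Ω j) y τ →
        W y τ = cfgExp (ι jj).η A' y τ ∧ ‖A' y τ‖ ≤ (2 * (L * (5 * (d : ℝ) * L * B₈ * (α₀ + α₁))) + 8 * (8 * B₀'' * (5 * (d : ℝ) * L * B₈) * (α₀ + α₁))) * ((L : ℝ) ^ j * (ι jj).η)⁻¹) →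
        (∀ y τ, (∀ j, j ≤ m → ¬ SideTouches ((ι jj).Ω j) y τ) → A' y τ = 0) →
        msup L m (ι jj).η (-(1 : ℝ)) (fun j (b : Site d × Fin d) => SideTouches ((ι jj).Ω j) b.1 b.2) (fun b => A' b.1 b.2)
        ≤ B₀' * (bondNorm L m (ι jj).η (-(3 : ℝ)) (ι jj).Ω (fun x μ => Jcur (ι jj).η U₀ A' μ x)
        + wsup 1 (fun p : {p : ℕ × (Site d × Fin d) // p.1 ≤ m ∧ p.2 ∈ (ι jj).Λb m p.1} =>
        linCovIter L U₀ (iEta (ι jj).η A') p.1.1 p.1.2.1 p.1.2.2)) + γ' * B₀' * (α₀ + α₁) ∧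
        msup L m (ι jj).η (-(2 : ℝ)) (fun j (t : Fin d × Fin d × Site d) => SideTouches ((ι jj).Ω j) t.2.2 t.2.1)
        (fun t => covDerivFwd (ι jj).η U₀ t.1 (fun z => A' z t.2.1) t.2.2)
        ≤ B₀' * (bondNorm L m (ι jj).η (-(3 : ℝ)) (ι jj).Ω (fun x μ => Jcur (ι jj).η U₀ A' μ x)
        + wsup 1 (fun p : {p : ℕ × (Site d × Fin d) // p.1 ≤ m ∧ p.2 ∈ (ι jj).Λb m p.1} =>
        linCovIter L U₀ (iEta (ι jj).η A') p.1.1 p.1.2.1 p.1.2.2)) + γ' * B₀' * (α₀ + α₁)) := by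
  obtain ⟨M₁, δ₀, a₀, B₀, Bβ, Bε, Bεβ, -, -, ha₀, hB₀, H⟩ := h33
  obtain ⟨M, hM_def⟩ : ∃ M : ℝ, M = max 1 (max M₁ M₃) := ⟨_, rfl⟩
  have hM1 : 1 ≤ M := by rw [hM_def]; exact le_max_left _ _
  have hMM₁ : M₁ ≤ M := by rw [hM_def]; exact (le_max_left _ _).trans (le_max_right _ _)
  have hMM₃ : M₃ ≤ M := by rw [hM_def]; exact (le_max_right _ _).trans (le_max_right _ _)
  have hM0 : 0 < M := lt_of_lt_of_le one_pos hM1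
  have hKM : 0 < K₆ * M := mul_pos hK₆ hM0
  have hL' : (1 : ℝ) ≤ L := by exact_mod_cast hL
  have hd' : (1 : ℝ) ≤ d := by exact_mod_cast (le_trans (by norm_num) hd2 : 1 ≤ d)
  obtain ⟨B', hB'_def⟩ : ∃ B' : ℝ, B' = max 1 (2 * B₀ * max 1 q) := ⟨_, rfl⟩
  have hB'1 : 1 ≤ B' := by rw [hB'_def]; exact le_max_left _ _
  have hB'0 : 0 < B' := lt_of_lt_of_le one_pos hB'1
  obtain ⟨cP, hcP_def⟩ : ∃ cP : ℝ,
      cP = min (1 / 16) (min (c₆ / M) (min (a₀ / (K₆ * M)) (min (a₃ / (K₆ * M)) (1 / (2 * B₀ * c69 * K₆ * M + 1))))) := ⟨_, rfl⟩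
  have hcP : 0 < cP := by
    rw [hcP_def]
    refine lt_min (by norm_num) (lt_min (div_pos hc₆ hM0) (lt_min (div_pos ha₀ hKM) (lt_min (div_pos ha₃ hKM) ?_)))
    have : 0 < 2 * B₀ * c69 * K₆ * M + 1 := by positivity
    positivity
  set K₀ : ℝ := 2 * (L * (5 * (d : ℝ) * L * B₈)) + 8 * (8 * B₀'' * (5 * (d : ℝ) * L * B₈)) with hK₀_def
  have hK₀ : 0 < K₀ := by
    have h1 : 0 < 2 * (L * (5 * (d : ℝ) * L * B₈)) := by positivity
    have h2 : 0 ≤ 8 * (8 * B₀'' * (5 * (d : ℝ) * L * B₈)) := by positivity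
    linarith
  refine ⟨B', min cP (cP / K₀), 2 * cS * γ₈ / B', hB'0, lt_min hcP (div_pos hcP hK₀), by positivity, fun jj => ?_⟩
  intro α₀ α₁ hα₀ hα₁ hs U₀ U' hU₀ hU' φ hφ hInA _ _ _ _ m _ hmk u W A' hu hW _ hLanF _ h41 hA0
  obtain ⟨⟨-, -, -, hφB⟩, hφF⟩ := hφ
  have hη : 0 < (ι jj).η := (ι jj).hη
  -- the smallness constant of the datum and the guard of the level-`m` socket
  set K : ℝ := 2 * (L * (5 * (d : ℝ) * L * B₈ * (α₀ + α₁))) + 8 * (8 * B₀'' * (5 * (d : ℝ) * L * B₈) * (α₀ + α₁)) with hK_def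
  have hKK₀ : K = K₀ * (α₀ + α₁) := by rw [hK_def, hK₀_def]; ring
  have hS0 : 0 < α₀ + α₁ := add_pos hα₀ hα₁
  have hKpos : 0 < K := by rw [hKK₀]; exact mul_pos hK₀ hS0
  have hα₀P : α₀ ≤ cP := by linarith only [hα₁, hs, min_le_left cP (cP / K₀)]
  have hKP : K ≤ cP := by
    have h1 : α₀ + α₁ ≤ cP / K₀ := hs.trans (min_le_right _ _)
    calc K = K₀ * (α₀ + α₁) := hKK₀
      _ ≤ K₀ * (cP / K₀) := mul_le_mul_of_nonneg_left h1 hK₀.le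
      _ = cP := by field_simp
  have hK16 : K ≤ 1 / 16 := hKP.trans (by rw [hcP_def]; exact min_le_left _ _)
  rw [hcP_def] at hα₀P
  -- the datum is a datum of the sourced core at level `m`
  have hWu : ∀ x κ, W x κ ∈ unitaryUnits 𝔸 := mem_unitaryUnits_of_mgauge_eq hU₀ hU' hu hW
  have hInAm : InAk L m (ι jj).η α₀ (ι jj).Ω U₀ := fun j hj => hInA j (hj.trans hmk)
  have hlog : ∀ (x : Site d) (μ : Fin d), BondTouches ((ι jj).Ω 0) x μ → logCfg (ι jj).η W x μ = A' x μ :=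
    fun x μ _ => logCfg_eq_of_univ L hd2 hη (hΩJ jj) U₀ hWu hK16 h41 x μ
  have hcl : ∃ μ : ℕ → Site d → 𝔸, ∀ x ∈ (ι jj).Ω 0,
      covLap (ι jj).η U₀ (((ι jj).Ω 0).indicator (covDivB (ι jj).η U₀ A' - φ)) x = QT L m ((ι jj).Λs m) U₀ μ x :=
    (mulClause_congr φ hlog).1 hLanF.1
  have h33U : ∀ (α : ℝ) (V : Site d → Fin d → 𝔸ˣ) (hV : ∀ x κ, V x κ ∈ unitaryUnits 𝔸), 0 < α → M * α ≤ a₀ →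
      (bg (mem M (ι jj) m)).Reg335 c35 α (ιCfg M (ι jj) m V hV) →
      B9.Ineq342_346_347 (GA (mem M (ι jj) m)) B₀ δ₀ (ιCfg M (ι jj) m V hV) ∧
        B9.Ineq343_345 (GA (mem M (ι jj) m)) Bβ Bε Bεβ δ₀ (ιCfg M (ι jj) m V hV) := by
    intro α V hV hα hMa hreg
    have hMi : M₁ ≤ (geo (mem M (ι jj) m)).M := by rw [(hdict M (ι jj) m).1]; exact hMM₁
    have hMa' : (geo (mem M (ι jj) m)).M * α ≤ a₀ := by rw [(hdict M (ι jj) m).1]; exact hMa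
    exact (H (mem M (ι jj) m) hMi α hα hMa' (ιCfg M (ι jj) m V hV) hreg).2
  obtain ⟨r1, r2, -, -, -⟩ := sockSrc_core_at_univ geo bg GA L mem ιCfg ιLoc ops hL hdict hP6 hinv hcurv havg hhol hadd hsrc hsrcH
    hK₆ hc69 hq hcS hcSβ hM1 hMM₃ (ι jj) (hΩJ jj) m hB₀ h33U α₀ K hα₀ hα₀P hKpos hK16 U₀ hU₀ hInAm A'
    (fun j hj y τ hs' => (h41 j hj y τ hs').2) hA0 φ hφB hcl
  rw [← hB'_def] at r1 r2
  obtain ⟨F, hF_def⟩ : ∃ F : ℝ, F = msup L (ι jj).k (ι jj).η (-(2 : ℝ)) (fun j (x : Site d) => x ∈ (ι jj).Ω j) φ := ⟨_, rfl⟩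
  rw [← hF_def] at r1 r2 hφF
  have hS : 2 * (cS * F) ≤ 2 * cS * γ₈ / B' * B' * (α₀ + α₁) := by
    have h1 : cS * F ≤ cS * (γ₈ * (α₀ + α₁)) := mul_le_mul_of_nonneg_left hφF.le hcS
    have h2 : 2 * cS * γ₈ / B' * B' * (α₀ + α₁) = 2 * (cS * (γ₈ * (α₀ + α₁))) := by field_simp
    linarith
  exact ⟨r1.trans (by linarith), r2.trans (by linarith)⟩

end Supply

#print axioms sockSrc_core_at_univ
#print axioms sockB9P3srcH_of_thm33_univ
#print axioms sockH59src_of_thm33_univ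

end Literature.MathematicalPhysics.QuantumFieldTheory.Balaban1983to89.B9SupplySockB9P3ZdSrc

end
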